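import Literature.AlgebraicGeometry.VanGeemen1994.WeilTypeSurfaceNonCMSquare
import Literature.AlgebraicGeometry.HodgeTheory.MaximalPicardNumberHodgeClasses
import Literature.AlgebraicGeometry.HodgeTheory.HodgeGroupProductSemisimpleCMFactor
import Literature.AlgebraicGeometry.HodgeTheory.WeilOperatorDegreeOne
import Literature.NumberTheory.EllipticCurves.CMEndomorphismOfMulMemLattice
import Literature.AlgebraicGeometry.HodgeTheory.HodgeClassesProductSpanCMSquare
import HarnessLib

/-!
# The square of a CM elliptic curve: its Hodge group is the Hodge circle, `HasHodgeGroupSU` holds for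
# degenerate data, and the first typing `HasSemisimpleHodgeGroup_of_hasHodgeGroupSU_statement` is FALSE

Pure Literature (theorems only: no new definition, no new named fact, no Summit import).

## What is proved

For a complex elliptic curve `E` WITH complex multiplication `ψ` (`ψ ≫ ψ = -d₀`, `d₀ ≥ 1`; Lange–Birkenhake
§1.2, van Geemen 5.3) and `A = E × E`:

* `CMSquare.isDivisorGenerated_powSucc` — `B• = D•` on every power of `E × E` (Tate / Murasaki: every
  `(1,0)`-class of `(E × E)^{N+1}` is a combination of pull-backs of the `(1,0)`-class of `E`; the tree's
  `EllipticCurve.hodgeClasses_divisorial_of_hodgeOneZero_mem_span_pullback`);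
* `CMSquare.hodgeGroupOne_eq_unitaryCentralizerGroup` — `Hg(E × E)(ℂ)|_{H¹} = S(E × E)(ℂ) = U(C)(h)` for the
  hyperplane-type class `h = e^*a + 𝟙^*e^*a` of any projective embedding (Milne 1999, Thm. 4.4, tree theorem
  `Milne1999.hodgeGroupOne_eq_unitaryCentralizerGroup_of_forall_isDivisorGenerated'`);
* `CMSquare.exists_circle_of_mem_unitaryCentralizerGroup` / `CMSquare.mem_unitaryCentralizerGroup_of_circle`,
  assembled in `CMSquare.mem_hodgeGroupOne_iff_circle` — `Hg(E × E)(ℂ)|_{H¹} = U(C)(h)` is the HODGE CIRCLE: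
  the automorphisms `z · π^{1,0} + z⁻¹ · π^{0,1}` of `H¹ = H^{1,0} ⊕ H^{0,1}`, `z ∈ ℂˣ`
  (`CMSquare.exists_circle_linearEquiv`; Gordon 2.12: the Hodge group of a CM abelian variety is a torus;
  here `Hg(E × E) ≅ Hg(E) = U(1)`, Moonen–Zarhin §2, `g = 1`);
* `CMSquare.hasHodgeGroupSU` — for the DEGENERATE data `n = 1`, `φ = ψ × 2ψ` (an endomorphism with four
  distinct eigenvalues `± μ, ± 2μ` on `H¹`, `φ ≫ φ ≠ -d` for every `d`), `d = 0` (off the spectrum of `φ^*`, so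
  both determinant clauses of `weilSpecialUnitaryGroup` bear on the ZERO eigenspace and are vacuous) and the
  `(1,1)`-class `h₃ = (p₁^*ω + p₂^*ω) ⌣ (p₁^*ω̄ + p₂^*ω̄)` (all four cross pairings `Q_{h₃}(pᵢ^*ω, pⱼ^*ω̄)` are
  `±` the volume class, hence non-zero), van Geemen's `SU_H(ℂ)` (`weilSpecialUnitaryGroup A φ 1 0 h₃`) IS the
  Hodge circle, so **`HasHodgeGroupSU (E × E) φ 1 0 h₃` holds** although `(E × E, φ)` is not of Weil type;
* `CMSquare.not_hasSemisimpleHodgeGroup` — `Hg(E × E)(ℂ)` is commutative and infinite, so its centre is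
  infinite: **`¬ HasSemisimpleHodgeGroup (E × E)`** (Gordon 2.12 on the carriers), and
  `exists_isOfCMType_not_hasSemisimpleHodgeGroup : ∃ A, IsOfCMType A ∧ ¬ HasSemisimpleHodgeGroup A` — the
  first UNCONDITIONAL instance of the tightness statement `exists_cmType_not_hasSemisimpleHodgeGroup_of` of
  `HodgeGroupProductSemisimpleCMFactor` (there modulo Gordon's splitting fact and Shioda's tightness fact);
* `not_hasSemisimpleHodgeGroup_of_hasHodgeGroupSU_statement` (with `…_of_cm` and `…_iff_false`) — **the first typing
  `HodgeTheory.HasSemisimpleHodgeGroup_of_hasHodgeGroupSU_statement` (file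
  `HodgeTheory/HodgeGroupProductSemisimpleCMFactor`, `∀ A φ n d h, 0 < n → dim A = 2n → HasHodgeGroupSU A φ n d h
  → HasSemisimpleHodgeGroup A`, typed WITHOUT the Weil-type hypotheses `0 < d`, `φ ≫ φ = -d`,
  `h = d·e^*a + φ^*e^*a`) is FALSE**, unconditionally (a CM elliptic curve exists in the tree:
  `CMEndomorphism.exists_cmCurve_sqrt_neg`). Its docstring already carries the CAUTION "expected to be FALSE
  (`E × E`, `E` CM …)" (cross-cell advisory of `pub-hodgecm2` b13, 2026-08-21); the CORRECTED statement
  `HasSemisimpleHodgeGroup_of_hasHodgeGroupSU_weilType_statement` (`LINK′`) is the tree's theorem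
  `VanGeemen1994.hasSemisimpleHodgeGroup_of_hasHodgeGroupSU_weilType` (`WeilTypeHodgeGroupSUCentre`). This file
  supplies the kernel witness that the correction was necessary; no theorem of the tree consumes the refuted
  statement.

## Architecture (van Geemen 5.3–5.4, 6.9–6.11; Milne 1999 §4; Moonen–Zarhin 1999 §2, `g = 1`)

1. `H¹(E × E) = p₁^*H¹(E) ⊕ p₂^*H¹(E)`, `H¹(E) = ℂω ⊕ ℂω̄` (`ω` of type `(1,0)`), `ψ^*ω = μω`, `ψ^*ω̄ = μ̄ω̄`,
   `μ² = -d₀`, `μ̄ = -μ ≠ μ` (`EllipticCurve.cm_eigenvalue`); the basis `b = (p₁^*ω, p₂^*ω, p₁^*ω̄, p₂^*ω̄)`;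
   `H^{1,0}(E × E) = ⟨p₁^*ω, p₂^*ω⟩`, `H^{0,1}(E × E) = ⟨p₁^*ω̄, p₂^*ω̄⟩`.
2. `U(C)(h) ⊆ circle`: `u` commutes with `(ψ × ψ)^*` (eigenspaces `H^{1,0}`, `H^{0,1}`), with the pull-backs
   of `(x, y) ↦ (x, 0)`, `(x, y) ↦ (0, y)` and of the swap, hence is a scalar `z` on `H^{1,0}` and `z'` on
   `H^{0,1}`; `Q_h`-invariance and non-degeneracy of `Q_h` (hard Lefschetz) give `z z' = 1`.
3. `circle ⊆ U(C)(h')` for every `(1,1)`-class `h'` (pull-backs commute with `π^{1,0}`, `π^{0,1}`; `H^{1,0}`,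
   `H^{0,1}` are `Q_{h'}`-isotropic), and `circle ⊆ SU(φ', 0, h')` for every `φ'` with `φ'^*` injective.
4. `SU(φ, 0, h₃) ⊆ circle` for `φ = ψ × 2ψ`: `φ^*` has the four eigenlines `ℂ bᵢ`, so `u bᵢ = sᵢ bᵢ`, and
   `Q_{h₃}(u bᵢ, u bⱼ) = Q_{h₃}(bᵢ, bⱼ) ≠ 0` for `i ∈ {0,1}`, `j ∈ {2,3}` forces `s₀ = s₁ = s₂⁻¹ = s₃⁻¹`.
5. `Hg|_{H¹} = U(C)(h)` (Milne Thm. 4.4 + `B• = D•` on powers) = circle = `SU(φ, 0, h₃)`: `HasHodgeGroupSU`.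
6. `Hg ≅ Hg|_{H¹}` (`hodgeGroup_ext_one`) is commutative and contains `{z · π^{1,0} + z⁻¹ · π^{0,1}}_{z ∈ ℂˣ}`,
   so its centre is all of `Hg`, infinite: `¬ HasSemisimpleHodgeGroup`.

## References

* [vanGeemen1994HodgeAV] B. van Geemen, *An introduction to the Hodge conjecture for abelian varieties*,
  LNM 1594 (1994): 5.3–5.4 (`E × E`, `E` with CM), 6.4–6.5, 6.9–6.12 (`U_H`, `SU_H`, "the special
  Mumford–Tate group is `SU_H`").
* [Gordon1999HodgeAVSurvey] B. B. Gordon, *A survey of the Hodge conjecture for abelian varieties* (1999):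
  1.3, 1.5 (semisimple, `SU(n)`), 2.12 (CM ⟺ `Hg` a torus).
* [Milne1999LefschetzClasses] J. S. Milne, *Lefschetz classes on abelian varieties*, Duke Math. J. 96 (1999),
  §1 (`C(A)`, `S(A)`), Thm. 4.4.
* [MoonenZarhin1999LowDim] B. Moonen, Yu. Zarhin, Math. Ann. 315 (1999), §2 (`g = 1`: `Hg(E) = U(1)` for CM `E`).
* [LangeBirkenhake1992] H. Lange, Ch. Birkenhake, *Complex Abelian Varieties*, §1.2, Lemma 1.1.17, Thm. 4.2.1.
* [Weil1977HodgeRing] A. Weil, *Abelian varieties and the Hodge ring* (1977): the Weil-type hypotheses that the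
  refuted typing omits.

HONEST SCOPE: nothing here bears on the Hodge conjecture; the file settles (negatively) one over-strong typed
statement of the tree and records the positive structure `Hg(E × E) = ` Hodge circle for CM `E`.
-/

noncomputable section

open CategoryTheory
open Literature.AlgebraicTopology.SingularHomology
open Literature.AlgebraicGeometry.Motives (IsSmoothProjective AbelianVariety polarizationPairingOne)

namespace Literature.AlgebraicGeometry.VanGeemen1994

open Literature.AlgebraicGeometry.HodgeTheory

namespace CMSquare

variable {E : AbelianVariety ℂ}

open Literature.AlgebraicGeometry.Motives.AbelianVariety (fst snd prodLift)

/-! ### §1 `H¹(E × E) = p₁^* H¹(E) ⊕ p₂^* H¹(E)`: the structure maps -/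

/-- `ι₁ ≫ p₁ = 𝟙`, `ι₁ ≫ p₂ = 0`, `ι₂ ≫ p₁ = 0`, `ι₂ ≫ p₂ = 𝟙`. [folklore] -/
private theorem ι_comp_p :
    (prodLift (𝟙 E) (0 : E ⟶ E) ≫ fst E E = 𝟙 E ∧ prodLift (𝟙 E) (0 : E ⟶ E) ≫ snd E E = 0) ∧
      (prodLift (0 : E ⟶ E) (𝟙 E) ≫ fst E E = 0 ∧ prodLift (0 : E ⟶ E) (𝟙 E) ≫ snd E E = 𝟙 E) :=
  ⟨⟨Motives.AbelianVariety.prodLift_fst _ _, Motives.AbelianVariety.prodLift_snd _ _⟩,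
    ⟨Motives.AbelianVariety.prodLift_fst _ _, Motives.AbelianVariety.prodLift_snd _ _⟩⟩

/-- `ι₁^* p₁^* w = w`. [folklore] -/
private theorem map_ι₁_map_p₁ (w : complexBetti E.X 1) :
    complexBetti.map (prodLift (𝟙 E) (0 : E ⟶ E)).hom.hom.hom 1 (complexBetti.map (fst E E).hom.hom.hom 1 w) = w := by
  rw [complexBetti_map_map_hom, ι_comp_p.1.1]
  change complexBetti.map (𝟙 E.X) 1 w = w
  rw [complexBetti.map_id]; rfl

/-- `ι₂^* p₂^* w = w`. [folklore] -/
private theorem map_ι₂_map_p₂ (w : complexBetti E.X 1) :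
    complexBetti.map (prodLift (0 : E ⟶ E) (𝟙 E)).hom.hom.hom 1 (complexBetti.map (snd E E).hom.hom.hom 1 w) = w := by
  rw [complexBetti_map_map_hom, ι_comp_p.2.2]
  change complexBetti.map (𝟙 E.X) 1 w = w
  rw [complexBetti.map_id]; rfl

/-- `ι₁^* p₂^* w = 0`. [folklore] -/
private theorem map_ι₁_map_p₂ (w : complexBetti E.X 1) :
    complexBetti.map (prodLift (𝟙 E) (0 : E ⟶ E)).hom.hom.hom 1 (complexBetti.map (snd E E).hom.hom.hom 1 w) = 0 := by
  rw [complexBetti_map_map_hom, ι_comp_p.1.2, complexBetti_map_zero_deg_one]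

/-- `ι₂^* p₁^* w = 0`. [folklore] -/
private theorem map_ι₂_map_p₁ (w : complexBetti E.X 1) :
    complexBetti.map (prodLift (0 : E ⟶ E) (𝟙 E)).hom.hom.hom 1 (complexBetti.map (fst E E).hom.hom.hom 1 w) = 0 := by
  rw [complexBetti_map_map_hom, ι_comp_p.2.1, complexBetti_map_zero_deg_one]

/-- `e₁₁^* p₁^* w = p₁^* w` for `e₁₁ = (x, y) ↦ (x, 0)`. [folklore] -/
private theorem map_e₁₁_map_p₁ (w : complexBetti E.X 1) :
    complexBetti.map (prodLift (fst E E) (0 : E.prod E ⟶ E)).hom.hom.hom 1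
        (complexBetti.map (fst E E).hom.hom.hom 1 w) =
      complexBetti.map (fst E E).hom.hom.hom 1 w := by
  rw [complexBetti_map_map_hom, Motives.AbelianVariety.prodLift_fst]

/-- `e₁₁^* p₂^* w = 0`. [folklore] -/
private theorem map_e₁₁_map_p₂ (w : complexBetti E.X 1) :
    complexBetti.map (prodLift (fst E E) (0 : E.prod E ⟶ E)).hom.hom.hom 1
        (complexBetti.map (snd E E).hom.hom.hom 1 w) = 0 := by
  rw [complexBetti_map_map_hom, Motives.AbelianVariety.prodLift_snd, complexBetti_map_zero_deg_one]

/-- `e₂₂^* p₂^* w = p₂^* w` for `e₂₂ = (x, y) ↦ (0, y)`. [folklore] -/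
private theorem map_e₂₂_map_p₂ (w : complexBetti E.X 1) :
    complexBetti.map (prodLift (0 : E.prod E ⟶ E) (snd E E)).hom.hom.hom 1
        (complexBetti.map (snd E E).hom.hom.hom 1 w) =
      complexBetti.map (snd E E).hom.hom.hom 1 w := by
  rw [complexBetti_map_map_hom, Motives.AbelianVariety.prodLift_snd]

/-- `e₂₂^* p₁^* w = 0`. [folklore] -/
private theorem map_e₂₂_map_p₁ (w : complexBetti E.X 1) :
    complexBetti.map (prodLift (0 : E.prod E ⟶ E) (snd E E)).hom.hom.hom 1
        (complexBetti.map (fst E E).hom.hom.hom 1 w) = 0 := by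
  rw [complexBetti_map_map_hom, Motives.AbelianVariety.prodLift_fst, complexBetti_map_zero_deg_one]

/-- `σ^* p₁^* w = p₂^* w` for the swap `σ = (x, y) ↦ (y, x)`. [folklore] -/
private theorem map_swap_map_p₁ (w : complexBetti E.X 1) :
    complexBetti.map (prodLift (snd E E) (fst E E)).hom.hom.hom 1 (complexBetti.map (fst E E).hom.hom.hom 1 w) =
      complexBetti.map (snd E E).hom.hom.hom 1 w := by
  rw [complexBetti_map_map_hom, Motives.AbelianVariety.prodLift_fst]

/-- `σ^* p₂^* w = p₁^* w`. [folklore] -/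
private theorem map_swap_map_p₂ (w : complexBetti E.X 1) :
    complexBetti.map (prodLift (snd E E) (fst E E)).hom.hom.hom 1 (complexBetti.map (snd E E).hom.hom.hom 1 w) =
      complexBetti.map (fst E E).hom.hom.hom 1 w := by
  rw [complexBetti_map_map_hom, Motives.AbelianVariety.prodLift_snd]

/-- `(f × g)^* p₁^* w = p₁^* f^* w` for `f × g = prodLift (p₁ ≫ f) (p₂ ≫ g)`. [folklore] -/
private theorem map_prodMap_map_p₁ (f g : E ⟶ E) (w : complexBetti E.X 1) :
    complexBetti.map (prodLift (fst E E ≫ f) (snd E E ≫ g)).hom.hom.hom 1 (complexBetti.map (fst E E).hom.hom.hom 1 w) =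
      complexBetti.map (fst E E).hom.hom.hom 1 (complexBetti.map f.hom.hom.hom 1 w) := by
  rw [complexBetti_map_map_hom, Motives.AbelianVariety.prodLift_fst, ← complexBetti_map_map_hom]

/-- `(f × g)^* p₂^* w = p₂^* g^* w`. [folklore] -/
private theorem map_prodMap_map_p₂ (f g : E ⟶ E) (w : complexBetti E.X 1) :
    complexBetti.map (prodLift (fst E E ≫ f) (snd E E ≫ g)).hom.hom.hom 1 (complexBetti.map (snd E E).hom.hom.hom 1 w) =
      complexBetti.map (snd E E).hom.hom.hom 1 (complexBetti.map g.hom.hom.hom 1 w) := by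
  rw [complexBetti_map_map_hom, Motives.AbelianVariety.prodLift_snd, ← complexBetti_map_map_hom]

/-! ### §2 The CM data: `ω`, `ω̄`, `μ` and the basis `(p₁^*ω, p₂^*ω, p₁^*ω̄, p₂^*ω̄)` -/

section CMData

variable (hE : E.dim = 1) {ψ : E ⟶ E} {d₀ : ℕ} (hd₀ : 0 < d₀) (hψ : ψ ≫ ψ = -(d₀ • 𝟙 E))
include hE hd₀ hψ

/-- **The CM eigen-data of `H¹(E)`**: a generator `ω` of `H^{1,0}(E)`, its conjugate `ω̄` generating
`H^{0,1}(E)`, and the eigenvalue `μ` of `ψ^*` on `ω` with `ψ^*ω̄ = -μ ω̄`, `μ ≠ 0` (`μ² = -d₀ < 0`, so `μ` is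
purely imaginary and `μ̄ = -μ`). [cite: LangeBirkenhake1992, §1.2 and Thm. 4.2.1] [cite: vanGeemen1994HodgeAV, 5.3] -/
theorem exists_cm_eigendata :
    ∃ (ω : complexBetti E.X 1) (μ : ℂ), IsOfHodgeType E.dim E.X 1 1 0 ω ∧ ω ≠ 0 ∧
      (∀ u : complexBetti E.X 1, IsOfHodgeType E.dim E.X 1 1 0 u → ∃ c : ℂ, u = c • ω) ∧
      (∀ v : complexBetti E.X 1, IsOfHodgeType E.dim E.X 1 0 1 v →
        ∃ c : ℂ, v = c • conjClass (Motives.ComplexPoints E.X) 1 ω) ∧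
      conjClass (Motives.ComplexPoints E.X) 1 ω ≠ 0 ∧
      complexBetti.map ψ.hom.hom.hom 1 ω = μ • ω ∧
      complexBetti.map ψ.hom.hom.hom 1 (conjClass (Motives.ComplexPoints E.X) 1 ω) =
        (-μ) • conjClass (Motives.ComplexPoints E.X) 1 ω ∧
      μ ≠ 0 := by
  obtain ⟨ω, hω, hω0, hgen⟩ := EllipticCurve.exists_hodgeOneZero_generator hE
  obtain ⟨μ, hμ, hμ2, -⟩ := EllipticCurve.cm_eigenvalue ψ hd₀ hψ hω hω0 hgen
  have hμ0 : μ ≠ 0 := by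
    intro h
    rw [h, zero_pow two_ne_zero] at hμ2
    have : (d₀ : ℂ) = 0 := by rw [← neg_neg (d₀ : ℂ), ← hμ2, neg_zero]
    exact (Nat.cast_ne_zero.2 hd₀.ne') this
  -- `μ̄ = -μ`: `μ² = -d₀` is a negative real
  have hconj : starRingEnd ℂ μ = -μ := by
    have hre := congrArg Complex.re hμ2
    have him := congrArg Complex.im hμ2
    simp only [pow_two, Complex.mul_re, Complex.mul_im, Complex.neg_re, Complex.neg_im, Complex.natCast_re,
      Complex.natCast_im, neg_zero] at hre him
    have hri : μ.re * μ.im = 0 := by nlinarith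
    have hre0 : μ.re = 0 := by
      rcases mul_eq_zero.1 hri with h | h
      · exact h
      · rw [h, mul_zero, sub_zero] at hre
        nlinarith [mul_self_nonneg μ.re, (Nat.cast_pos.2 hd₀ : (0 : ℝ) < d₀)]
    apply Complex.ext
    · simp [hre0]
    · simp
  refine ⟨ω, μ, hω, hω0, hgen, fun v hv => EllipticCurve.exists_eq_smul_conj hgen v hv, ?_, hμ, ?_, hμ0⟩
  · intro h
    apply hω0
    rw [← conjClass_conjClass ω, h, conjClass_zero]
  · have h1 : conjClass (Motives.ComplexPoints E.X) 1 (complexBetti.map ψ.hom.hom.hom 1 ω) =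
        complexBetti.map ψ.hom.hom.hom 1 (conjClass (Motives.ComplexPoints E.X) 1 ω) := by
      rw [conjClass_map]
    rw [← h1, hμ, conjClass_smul, hconj]

end CMData

/-! ### §3 The square `A = E × E`: Hodge types of the basis vectors and their independence -/

section Square

variable (hE : E.dim = 1) {ω : complexBetti E.X 1}
  (hω : IsOfHodgeType E.dim E.X 1 1 0 ω) (hω0 : ω ≠ 0)
  (hgen : ∀ u : complexBetti E.X 1, IsOfHodgeType E.dim E.X 1 1 0 u → ∃ c : ℂ, u = c • ω)
  (hgen' : ∀ v : complexBetti E.X 1, IsOfHodgeType E.dim E.X 1 0 1 v →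
    ∃ c : ℂ, v = c • conjClass (Motives.ComplexPoints E.X) 1 ω)
  (hωc0 : conjClass (Motives.ComplexPoints E.X) 1 ω ≠ 0)

-- Notation of the comments, as local abbreviations inside statements: `P₁ = p₁^*`, `P₂ = p₂^*` on `H¹`,
-- `ω̄ = conj ω`.
set_option quotPrecheck false in
local notation "P₁" => complexBetti.map (fst E E).hom.hom.hom 1
set_option quotPrecheck false in
local notation "P₂" => complexBetti.map (snd E E).hom.hom.hom 1
set_option quotPrecheck false in
local notation "ω̄" => conjClass (Motives.ComplexPoints E.X) 1 ω

/-- `dim (E × E) = 1 + 1`: the square of an elliptic curve is an abelian surface. [cite: vanGeemen1994HodgeAV, 5.4] -/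
theorem dim_sq (hE : E.dim = 1) : (E.prod E).dim = 1 + 1 := by
  rw [Motives.AbelianVariety.dim_prod, hE]

include hE hω in
/-- `p₁^*ω`, `p₂^*ω ∈ H^{1,0}(E × E)`. [cite: VoisinHodgeI2002, §7.3.2] -/
theorem map_p_mem_hodgeOneZero :
    P₁ ω ∈ hodgeOneZero (Motives.isSmoothProjective_of_dim_eq' (dim_sq hE)) ∧
      P₂ ω ∈ hodgeOneZero (Motives.isSmoothProjective_of_dim_eq' (dim_sq hE)) := by
  have hXA := Motives.isSmoothProjective_of_dim_eq' (dim_sq hE)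
  have hXE : IsSmoothProjective E.dim E.X := Motives.AbelianVariety.isSmoothProjective_holds
  exact ⟨(mem_hodgeOneZero hXA).2 (hω.map_of_isSmoothProjective hXA hXE _),
    (mem_hodgeOneZero hXA).2 (hω.map_of_isSmoothProjective hXA hXE _)⟩

include hE hω in
/-- `p₁^*ω̄`, `p₂^*ω̄ ∈ H^{0,1}(E × E)`. [cite: VoisinHodgeI2002, §6.1.3 and §7.3.2] -/
theorem map_p_conj_mem_hodgeZeroOne :
    P₁ ω̄ ∈ hodgeZeroOne (Motives.isSmoothProjective_of_dim_eq' (dim_sq hE)) ∧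
      P₂ ω̄ ∈ hodgeZeroOne (Motives.isSmoothProjective_of_dim_eq' (dim_sq hE)) := by
  have hXA := Motives.isSmoothProjective_of_dim_eq' (dim_sq hE)
  have hXE : IsSmoothProjective E.dim E.X := Motives.AbelianVariety.isSmoothProjective_holds
  have hωc : IsOfHodgeType E.dim E.X 1 0 1 ω̄ := hω.conjClass hXE
  exact ⟨(mem_hodgeZeroOne hXA).2 (hωc.map_of_isSmoothProjective hXA hXE _),
    (mem_hodgeZeroOne hXA).2 (hωc.map_of_isSmoothProjective hXA hXE _)⟩

include hE hgen in
/-- **`H^{1,0}(E × E) = ℂ p₁^*ω ⊕ ℂ p₂^*ω`**: every `(1,0)`-class of `E × E` is `a p₁^*ω + b p₂^*ω`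
(Künneth in degree one with types, `H^{1,0}(E) = ℂω`). [cite: LangeBirkenhake1992, Thm. 4.2.1] [cite: VoisinHodgeI2002, §11.3.3] -/
theorem exists_eq_of_mem_hodgeOneZero {x : complexBetti (E.prod E).X 1}
    (hx : x ∈ hodgeOneZero (Motives.isSmoothProjective_of_dim_eq' (dim_sq hE))) :
    ∃ a b : ℂ, x = a • P₁ ω + b • P₂ ω := by
  have hx' : IsOfHodgeType (E.prod E).dim (E.prod E).X 1 1 0 x := by
    rw [dim_sq hE]; exact (mem_hodgeOneZero _).1 hx
  obtain ⟨u, v, hu, hv, rfl⟩ := AbelianVariety.exists_eq_of_hodgeOneZero_prod E E x hx'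
  obtain ⟨a, rfl⟩ := hgen u hu
  obtain ⟨b, rfl⟩ := hgen v hv
  exact ⟨a, b, by rw [map_smul, map_smul]⟩

include hE hgen' in
/-- **`H^{0,1}(E × E) = ℂ p₁^*ω̄ ⊕ ℂ p₂^*ω̄`**. [cite: LangeBirkenhake1992, Thm. 4.2.1] [cite: VoisinHodgeI2002, §11.3.3] -/
theorem exists_eq_of_mem_hodgeZeroOne {x : complexBetti (E.prod E).X 1}
    (hx : x ∈ hodgeZeroOne (Motives.isSmoothProjective_of_dim_eq' (dim_sq hE))) :
    ∃ a b : ℂ, x = a • P₁ ω̄ + b • P₂ ω̄ := by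
  have hx' : IsOfHodgeType (E.prod E).dim (E.prod E).X 1 0 1 x := by
    rw [dim_sq hE]; exact (mem_hodgeZeroOne _).1 hx
  obtain ⟨u, v, hu, hv, rfl⟩ := AbelianVariety.exists_eq_of_hodgeZeroOne_prod E E x hx'
  obtain ⟨a, rfl⟩ := hgen' u hu
  obtain ⟨b, rfl⟩ := hgen' v hv
  exact ⟨a, b, by rw [map_smul, map_smul]⟩

include hE hgen hgen' in
/-- **Every class of `H¹(E × E)` in the basis `(p₁^*ω, p₂^*ω, p₁^*ω̄, p₂^*ω̄)`** (`H¹ = H^{1,0} ⊕ H^{0,1}`).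
[cite: VoisinHodgeI2002, §6.1.3 Cor. 6.14] [cite: LangeBirkenhake1992, Thm. 4.2.1] -/
theorem exists_coords (x : complexBetti (E.prod E).X 1) :
    ∃ a₁ a₂ b₁ b₂ : ℂ, x = a₁ • P₁ ω + a₂ • P₂ ω + (b₁ • P₁ ω̄ + b₂ • P₂ ω̄) := by
  have hXA := Motives.isSmoothProjective_of_dim_eq' (dim_sq hE)
  obtain ⟨a₁, a₂, ha⟩ := exists_eq_of_mem_hodgeOneZero hE hgen (projOneZero_mem hXA x)
  obtain ⟨b₁, b₂, hb⟩ := exists_eq_of_mem_hodgeZeroOne hE hgen' (projZeroOne_mem hXA x)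
  refine ⟨a₁, a₂, b₁, b₂, ?_⟩
  rw [← ha, ← hb, projOneZero_add_projZeroOne]

include hE hω hω0 hωc0 in
/-- **Independence of `(p₁^*ω, p₂^*ω, p₁^*ω̄, p₂^*ω̄)`**: a vanishing combination has all coefficients zero
(project to `H^{1,0}` / `H^{0,1}`, then restrict to the two axes `ι₁`, `ι₂`). [cite: LangeBirkenhake1992, Thm. 4.2.1] -/
theorem coords_eq_zero {a₁ a₂ b₁ b₂ : ℂ}
    (h : a₁ • P₁ ω + a₂ • P₂ ω + (b₁ • P₁ ω̄ + b₂ • P₂ ω̄) = 0) :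
    a₁ = 0 ∧ a₂ = 0 ∧ b₁ = 0 ∧ b₂ = 0 := by
  have hXA := Motives.isSmoothProjective_of_dim_eq' (dim_sq hE)
  obtain ⟨h1, h2⟩ := map_p_mem_hodgeOneZero hE hω
  obtain ⟨h3, h4⟩ := map_p_conj_mem_hodgeZeroOne hE hω
  have h10 : a₁ • P₁ ω + a₂ • P₂ ω ∈ hodgeOneZero hXA :=
    Submodule.add_mem _ (Submodule.smul_mem _ _ h1) (Submodule.smul_mem _ _ h2)
  have h01 : b₁ • P₁ ω̄ + b₂ • P₂ ω̄ ∈ hodgeZeroOne hXA :=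
    Submodule.add_mem _ (Submodule.smul_mem _ _ h3) (Submodule.smul_mem _ _ h4)
  -- the two components vanish separately
  have hA0 : a₁ • P₁ ω + a₂ • P₂ ω = 0 := by
    have := projOneZero_eq_of_add_eq hXA h10 h01 h
    rw [map_zero] at this
    exact this.symm
  have hB0 : b₁ • P₁ ω̄ + b₂ • P₂ ω̄ = 0 := by
    have := projZeroOne_eq_of_add_eq hXA h10 h01 h
    rw [map_zero] at this
    exact this.symm
  -- restrict to the axes
  have ha₁ : a₁ = 0 := by
    have h' := congrArg (complexBetti.map (prodLift (𝟙 E) (0 : E ⟶ E)).hom.hom.hom 1) hA0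
    rw [map_add, map_smul, map_smul, map_ι₁_map_p₁, map_ι₁_map_p₂, smul_zero, add_zero, map_zero] at h'
    exact (smul_eq_zero.1 h').resolve_right hω0
  have ha₂ : a₂ = 0 := by
    have h' := congrArg (complexBetti.map (prodLift (0 : E ⟶ E) (𝟙 E)).hom.hom.hom 1) hA0
    rw [map_add, map_smul, map_smul, map_ι₂_map_p₁, map_ι₂_map_p₂, smul_zero, zero_add, map_zero] at h'
    exact (smul_eq_zero.1 h').resolve_right hω0
  have hb₁ : b₁ = 0 := by
    have h' := congrArg (complexBetti.map (prodLift (𝟙 E) (0 : E ⟶ E)).hom.hom.hom 1) hB0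
    rw [map_add, map_smul, map_smul, map_ι₁_map_p₁, map_ι₁_map_p₂, smul_zero, add_zero, map_zero] at h'
    exact (smul_eq_zero.1 h').resolve_right hωc0
  have hb₂ : b₂ = 0 := by
    have h' := congrArg (complexBetti.map (prodLift (0 : E ⟶ E) (𝟙 E)).hom.hom.hom 1) hB0
    rw [map_add, map_smul, map_smul, map_ι₂_map_p₁, map_ι₂_map_p₂, smul_zero, zero_add, map_zero] at h'
    exact (smul_eq_zero.1 h').resolve_right hωc0
  exact ⟨ha₁, ha₂, hb₁, hb₂⟩

include hE hω hω0 hωc0 in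
/-- **The family `(p₁^*ω, p₂^*ω, p₁^*ω̄, p₂^*ω̄)` is linearly independent** (it is a basis of `H¹(E × E)`).
[cite: LangeBirkenhake1992, Thm. 4.2.1] -/
theorem linearIndependent_basis : LinearIndependent ℂ ![P₁ ω, P₂ ω, P₁ ω̄, P₂ ω̄] := by
  rw [Fintype.linearIndependent_iff]
  intro g hg
  rw [Fin.sum_univ_four] at hg
  simp only [Matrix.cons_val_zero, Matrix.cons_val_one, Matrix.head_cons, Matrix.cons_val_two,
    Matrix.tail_cons, Matrix.cons_val_three] at hg
  have h := coords_eq_zero hE hω hω0 hωc0 (a₁ := g 0) (a₂ := g 1) (b₁ := g 2) (b₂ := g 3) (by rw [← hg]; abel)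
  intro i
  fin_cases i
  · exact h.1
  · exact h.2.1
  · exact h.2.2.1
  · exact h.2.2.2

/-! ### §4 The Hodge circle `z · π^{1,0} + z⁻¹ · π^{0,1}`: it lies in `U(C)(h')` and in `SU(φ', 0, h')` -/

/-- The determinant clause of `weilSpecialUnitaryGroup` on a ZERO eigenspace is vacuous. [folklore] -/
private theorem detOnEigenspace_eq_one_of_eigenspace_eq_bot {V : Type*} [AddCommGroup V] [Module ℂ V]
    (u : V ≃ₗ[ℂ] V) (T : Module.End ℂ V) (hc : ∀ x, u (T x) = T (u x)) {ε : ℂ}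
    (h : T.eigenspace ε = ⊥) : detOnEigenspace u T hc ε = 1 := by
  unfold detOnEigenspace
  refine LinearMap.det_eq_one_of_finrank_eq_zero ?_ _
  rw [h, finrank_bot]

include hE in
/-- **The Hodge circle lies in Milne's `S(E × E)(ℂ) = U(C)(h')` for every `(1,1)`-class `h'`**: an
automorphism `z · π^{1,0} + z⁻¹ · π^{0,1}` commutes with every endomorphism pull-back (pull-backs commute with
the projections `π^{1,0}`, `π^{0,1}`) and preserves `Q_{h'}` (`H^{1,0}`, `H^{0,1}` are `Q_{h'}`-isotropic).
[cite: Milne1999LefschetzClasses, §1 p. 644] [cite: VoisinHodgeI2002, §7.1.2 and §7.3.2] -/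
theorem mem_unitaryCentralizerGroup_of_circle {u : complexBetti (E.prod E).X 1 ≃ₗ[ℂ] complexBetti (E.prod E).X 1}
    {z : ℂ} (hz : z ≠ 0)
    (hu : ∀ x, u x = z • projOneZero (Motives.isSmoothProjective_of_dim_eq' (dim_sq hE)) x +
      z⁻¹ • projZeroOne (Motives.isSmoothProjective_of_dim_eq' (dim_sq hE)) x)
    {h : complexBetti (E.prod E).X 2} (hh : IsOfHodgeType (1 + 1) (E.prod E).X 2 1 1 h) :
    u ∈ Milne1999.unitaryCentralizerGroup (E.prod E) h := by
  set hXA := Motives.isSmoothProjective_of_dim_eq' (dim_sq hE) with hXAdef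
  refine Milne1999.mem_unitaryCentralizerGroup_iff.2 ⟨Milne1999.mem_centralizerGroup_iff.2 fun φ x => ?_, ?_⟩
  · change u (complexBetti.map φ.hom.hom.hom 1 x) = complexBetti.map φ.hom.hom.hom 1 (u x)
    rw [hu, hu, map_add, map_smul, map_smul, (map_projOneZero hXA hXA φ.hom.hom.hom x).2,
      map_projZeroOne hXA hXA φ.hom.hom.hom x]
  · have key : ∀ j, j = 1 → ∀ x y : complexBetti (E.prod E).X 1,
        polarizationPairingOne (E.prod E).X h j (u x) (u y) = polarizationPairingOne (E.prod E).X h j x y := by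
      intro j hj x y
      subst hj
      set Q := polarizationPairingOne (E.prod E).X h 1 with hQ
      have h10 : ∀ a b, Q (projOneZero hXA a) (projOneZero hXA b) = 0 := fun a b =>
        polarizationPairingOne_eq_zero_of_mem_hodgeOneZero hXA hh (projOneZero_mem hXA a) (projOneZero_mem hXA b)
      have h01 : ∀ a b, Q (projZeroOne hXA a) (projZeroOne hXA b) = 0 := fun a b =>
        polarizationPairingOne_eq_zero_of_mem_hodgeZeroOne hXA hh (projZeroOne_mem hXA a) (projZeroOne_mem hXA b)
      have hexp : ∀ a b, Q a b = Q (projOneZero hXA a) (projZeroOne hXA b) + Q (projZeroOne hXA a) (projOneZero hXA b) := by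
        intro a b
        conv_lhs => rw [← projOneZero_add_projZeroOne hXA a, ← projOneZero_add_projZeroOne hXA b]
        simp only [map_add, LinearMap.add_apply, h10, h01, zero_add, add_zero]
        abel
      rw [hexp x y, hu, hu]
      simp only [map_add, map_smul, LinearMap.add_apply, LinearMap.smul_apply, h10, h01, smul_zero, zero_add,
        add_zero, smul_smul, mul_inv_cancel₀ hz, inv_mul_cancel₀ hz, one_smul]
      abel
    exact key ((E.prod E).dim - 1) (by rw [dim_sq hE])

include hE in
/-- **The Hodge circle lies in `SU(φ', d = 0, h')` for every `(1,1)`-class `h'` and every endomorphism `φ'`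
with `φ'^*` injective on `H¹`**: it commutes with `φ'^*`, preserves `Q_{h'}`, and both determinant clauses of
van Geemen's `SU_H(ℂ)` — taken at the eigenvalue `± i√0 = 0`, i.e. on `ker φ'^* = 0` — are vacuous.
[cite: vanGeemen1994HodgeAV, 6.9 and Lemma 6.10] -/
theorem mem_weilSpecialUnitaryGroup_of_circle {u : complexBetti (E.prod E).X 1 ≃ₗ[ℂ] complexBetti (E.prod E).X 1}
    {z : ℂ} (hz : z ≠ 0)
    (hu : ∀ x, u x = z • projOneZero (Motives.isSmoothProjective_of_dim_eq' (dim_sq hE)) x +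
      z⁻¹ • projZeroOne (Motives.isSmoothProjective_of_dim_eq' (dim_sq hE)) x)
    {h : complexBetti (E.prod E).X 2} (hh : IsOfHodgeType (1 + 1) (E.prod E).X 2 1 1 h) (φ' : E.prod E ⟶ E.prod E)
    (hinj : Function.Injective (complexBetti.map φ'.hom.hom.hom 1)) :
    u ∈ weilSpecialUnitaryGroup (E.prod E) φ' 1 0 h := by
  have hU := mem_unitaryCentralizerGroup_of_circle hE hz hu hh
  obtain ⟨hc, hQ⟩ := Milne1999.mem_unitaryCentralizerGroup_iff.1 hU
  have hc' : ∀ x, u (pullbackOne (E.prod E) φ' x) = pullbackOne (E.prod E) φ' (u x) :=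
    fun x => Milne1999.mem_centralizerGroup_iff.1 hc φ' x
  have hε : Complex.I * ((Real.sqrt ((0 : ℕ) : ℝ) : ℝ) : ℂ) = 0 := by
    rw [Nat.cast_zero, Real.sqrt_zero, Complex.ofReal_zero, mul_zero]
  have hker : (pullbackOne (E.prod E) φ').eigenspace 0 = ⊥ := by
    rw [Module.End.eigenspace_zero]
    exact LinearMap.ker_eq_bot.2 hinj
  refine mem_weilSpecialUnitaryGroup_iff.2 ⟨hc', ?_, ?_, ?_⟩
  · have key : ∀ j, j = 1 → ∀ x y : complexBetti (E.prod E).X 1,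
        polarizationPairingOne (E.prod E).X h j (u x) (u y) = polarizationPairingOne (E.prod E).X h j x y := by
      intro j hj; subst hj
      have key' : ∀ j, (E.prod E).dim - 1 = j → ∀ x y : complexBetti (E.prod E).X 1,
          polarizationPairingOne (E.prod E).X h j (u x) (u y) = polarizationPairingOne (E.prod E).X h j x y := by
        intro j hj; subst hj; exact hQ
      exact key' 1 (by rw [dim_sq hE])
    exact key (2 * 1 - 1) (by norm_num)
  · rw [hε]; exact detOnEigenspace_eq_one_of_eigenspace_eq_bot u _ hc' hker
  · rw [hε, neg_zero]; exact detOnEigenspace_eq_one_of_eigenspace_eq_bot u _ hc' hker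

/-! ### §5 `U(C)(h) ⊆` Hodge circle for a CM square (the endomorphisms `ψ × ψ`, `(x,y) ↦ (x,0)`, the swap) -/

section CM

variable {ψ : E ⟶ E} {μ : ℂ} (hψω : complexBetti.map ψ.hom.hom.hom 1 ω = μ • ω)
  (hψω' : complexBetti.map ψ.hom.hom.hom 1 (conjClass (Motives.ComplexPoints E.X) 1 ω) =
    (-μ) • conjClass (Motives.ComplexPoints E.X) 1 ω)
  (hμ0 : μ ≠ 0)

include hE hgen hgen' hψω hψω' in
/-- **`(ψ × ψ)^* = μ · π^{1,0} - μ · π^{0,1}`** on `H¹(E × E)`: the diagonal complex multiplication acts by `μ` on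
`H^{1,0} = ⟨p₁^*ω, p₂^*ω⟩` and by `μ̄ = -μ` on `H^{0,1}`. [cite: LangeBirkenhake1992, §1.2 and Thm. 4.2.1] -/
theorem map_diag_eq (x : complexBetti (E.prod E).X 1) :
    complexBetti.map (prodLift (fst E E ≫ ψ) (snd E E ≫ ψ)).hom.hom.hom 1 x =
      μ • projOneZero (Motives.isSmoothProjective_of_dim_eq' (dim_sq hE)) x -
        μ • projZeroOne (Motives.isSmoothProjective_of_dim_eq' (dim_sq hE)) x := by
  have hXA := Motives.isSmoothProjective_of_dim_eq' (dim_sq hE)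
  obtain ⟨a₁, a₂, ha⟩ := exists_eq_of_mem_hodgeOneZero hE hgen (projOneZero_mem hXA x)
  obtain ⟨b₁, b₂, hb⟩ := exists_eq_of_mem_hodgeZeroOne hE hgen' (projZeroOne_mem hXA x)
  conv_lhs => rw [← projOneZero_add_projZeroOne hXA x]
  rw [ha, hb, map_add, map_add, map_add, map_smul, map_smul, map_smul, map_smul,
    map_prodMap_map_p₁, map_prodMap_map_p₁, map_prodMap_map_p₂, map_prodMap_map_p₂, hψω, hψω']
  simp only [map_smul]
  module

include hE hgen hgen' hψω hψω' hμ0 in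
/-- **An automorphism commuting with `(ψ × ψ)^*` preserves `H^{1,0}` and `H^{0,1}`** (the two eigenspaces of
`(ψ × ψ)^*`, eigenvalues `μ ≠ -μ`). [cite: vanGeemen1994HodgeAV, Lemma 6.10 (proof)] -/
theorem map_mem_of_comm_diag {u : complexBetti (E.prod E).X 1 ≃ₗ[ℂ] complexBetti (E.prod E).X 1}
    (hc : ∀ x, u (complexBetti.map (prodLift (fst E E ≫ ψ) (snd E E ≫ ψ)).hom.hom.hom 1 x) =
      complexBetti.map (prodLift (fst E E ≫ ψ) (snd E E ≫ ψ)).hom.hom.hom 1 (u x)) :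
    (∀ x ∈ hodgeOneZero (Motives.isSmoothProjective_of_dim_eq' (dim_sq hE)),
        u x ∈ hodgeOneZero (Motives.isSmoothProjective_of_dim_eq' (dim_sq hE))) ∧
      ∀ x ∈ hodgeZeroOne (Motives.isSmoothProjective_of_dim_eq' (dim_sq hE)),
        u x ∈ hodgeZeroOne (Motives.isSmoothProjective_of_dim_eq' (dim_sq hE)) := by
  have hXA := Motives.isSmoothProjective_of_dim_eq' (dim_sq hE)
  have hdiag := map_diag_eq hE hgen hgen' hψω hψω'
  have h2μ : (2 : ℂ) * μ ≠ 0 := mul_ne_zero two_ne_zero hμ0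
  constructor
  · intro x hx
    -- `(ψ × ψ)^* (u x) = μ (u x)`, so the `(0,1)`-component of `u x` vanishes
    have h1 : complexBetti.map (prodLift (fst E E ≫ ψ) (snd E E ≫ ψ)).hom.hom.hom 1 (u x) = μ • u x := by
      rw [← hc, hdiag, projOneZero_of_mem_hodgeOneZero hXA hx, projZeroOne_of_mem_hodgeOneZero hXA hx, smul_zero,
        sub_zero, map_smul]
    rw [hdiag] at h1
    have h2 : ((2 : ℂ) * μ) • projZeroOne hXA (u x) = 0 := by
      have h3 : μ • projOneZero hXA (u x) - μ • projZeroOne hXA (u x) =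
          μ • (projOneZero hXA (u x) + projZeroOne hXA (u x)) := by
        rw [h1, projOneZero_add_projZeroOne]
      calc ((2 : ℂ) * μ) • projZeroOne hXA (u x)
          = μ • (projOneZero hXA (u x) + projZeroOne hXA (u x)) -
              (μ • projOneZero hXA (u x) - μ • projZeroOne hXA (u x)) := by module
        _ = 0 := sub_eq_zero.2 h3.symm
    rw [← projZeroOne_eq_zero_iff hXA]
    exact (smul_eq_zero.1 h2).resolve_left h2μ
  · intro x hx
    have h1 : complexBetti.map (prodLift (fst E E ≫ ψ) (snd E E ≫ ψ)).hom.hom.hom 1 (u x) = (-μ) • u x := by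
      rw [← hc, hdiag, projOneZero_of_mem_hodgeZeroOne hXA hx, projZeroOne_of_mem_hodgeZeroOne hXA hx, smul_zero,
        zero_sub, map_neg, map_smul, neg_smul]
    rw [hdiag] at h1
    have h2 : ((2 : ℂ) * μ) • projOneZero hXA (u x) = 0 := by
      have h3 : μ • projOneZero hXA (u x) - μ • projZeroOne hXA (u x) =
          (-μ) • (projOneZero hXA (u x) + projZeroOne hXA (u x)) := by
        rw [h1, projOneZero_add_projZeroOne]
      calc ((2 : ℂ) * μ) • projOneZero hXA (u x)
          = (μ • projOneZero hXA (u x) - μ • projZeroOne hXA (u x)) -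
              (-μ) • (projOneZero hXA (u x) + projZeroOne hXA (u x)) := by module
        _ = 0 := sub_eq_zero.2 h3
    rw [← projOneZero_eq_zero_iff hXA]
    exact (smul_eq_zero.1 h2).resolve_left h2μ

include hE hω hω0 hgen hgen' hωc0 hψω hψω' hμ0 in
/-- **`U(C)(h) ⊆` Hodge circle** for the CM square: an automorphism of `H¹(E × E)` commuting with every
endomorphism pull-back and preserving a NON-DEGENERATE polarization pairing `Q_h` of a `(1,1)`-class `h` is
`z · π^{1,0} + z⁻¹ · π^{0,1}` for some `z ∈ ℂˣ`. Proof: it preserves `H^{1,0}`, `H^{0,1}` (commutes with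
`(ψ × ψ)^*`); commuting with `((x,y) ↦ (x,0))^*` and with the swap makes it the scalar `z` on
`H^{1,0} = ⟨p₁^*ω, p₂^*ω⟩` and `z'` on `H^{0,1}`; `Q_h(p₁^*ω, ·) ≠ 0` on `H^{0,1}` gives `z z' = 1`.
(Gordon 2.12 / Milne: the Lefschetz group of `E × E`, `E` CM, is the norm-one torus of `k`.)
[cite: Gordon1999HodgeAVSurvey, 2.12 Proposition] [cite: Milne1999LefschetzClasses, §1 p. 644 and Thm. 4.4] -/
theorem exists_circle_of_mem_unitaryCentralizerGroup {h : complexBetti (E.prod E).X 2}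
    (hh : IsOfHodgeType (1 + 1) (E.prod E).X 2 1 1 h)
    (hnd : ∀ x : complexBetti (E.prod E).X 1, (∀ y, polarizationPairingOne (E.prod E).X h 1 x y = 0) → x = 0)
    {u : complexBetti (E.prod E).X 1 ≃ₗ[ℂ] complexBetti (E.prod E).X 1}
    (hu : u ∈ Milne1999.unitaryCentralizerGroup (E.prod E) h) :
    ∃ z : ℂ, z ≠ 0 ∧ ∀ x, u x = z • projOneZero (Motives.isSmoothProjective_of_dim_eq' (dim_sq hE)) x +
      z⁻¹ • projZeroOne (Motives.isSmoothProjective_of_dim_eq' (dim_sq hE)) x := by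
  have hXA := Motives.isSmoothProjective_of_dim_eq' (dim_sq hE)
  obtain ⟨hc, hQ'⟩ := Milne1999.mem_unitaryCentralizerGroup_iff.1 hu
  have hc' : ∀ (φ : E.prod E ⟶ E.prod E) x, u (complexBetti.map φ.hom.hom.hom 1 x) =
      complexBetti.map φ.hom.hom.hom 1 (u x) := fun φ x => Milne1999.mem_centralizerGroup_iff.1 hc φ x
  set Q := polarizationPairingOne (E.prod E).X h 1 with hQdef
  have hQ : ∀ x y, Q (u x) (u y) = Q x y := by
    have key : ∀ j, (E.prod E).dim - 1 = j → ∀ x y : complexBetti (E.prod E).X 1,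
        polarizationPairingOne (E.prod E).X h j (u x) (u y) = polarizationPairingOne (E.prod E).X h j x y := by
      intro j hj; subst hj; exact hQ'
    exact key 1 (by rw [dim_sq hE])
  obtain ⟨hpres10, hpres01⟩ := map_mem_of_comm_diag hE hgen hgen' hψω hψω' hμ0 (u := u) (hc' _)
  obtain ⟨hm1, hm2⟩ := map_p_mem_hodgeOneZero hE hω
  obtain ⟨hm3, hm4⟩ := map_p_conj_mem_hodgeZeroOne hE hω
  -- `u (p₁^*ω) = s • p₁^*ω`
  obtain ⟨s, b, hsb⟩ := exists_eq_of_mem_hodgeOneZero hE hgen (hpres10 _ hm1)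
  have hb : b = 0 := by
    have h1 := hc' (prodLift (fst E E) (0 : E.prod E ⟶ E)) (complexBetti.map (fst E E).hom.hom.hom 1 ω)
    rw [map_e₁₁_map_p₁, hsb, map_add, map_smul, map_smul, map_e₁₁_map_p₁, map_e₁₁_map_p₂, smul_zero, add_zero] at h1
    have h2 : b • complexBetti.map (snd E E).hom.hom.hom 1 ω = 0 := by
      have := congrArg (fun y => y - s • complexBetti.map (fst E E).hom.hom.hom 1 ω) h1
      rwa [add_sub_cancel_left, sub_self] at this
    have h3 := congrArg (complexBetti.map (prodLift (0 : E ⟶ E) (𝟙 E)).hom.hom.hom 1) h2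
    rw [map_smul, map_ι₂_map_p₂, map_zero] at h3
    exact (smul_eq_zero.1 h3).resolve_right hω0
  rw [hb, zero_smul, add_zero] at hsb
  -- `u (p₂^*ω) = s • p₂^*ω` (swap)
  have hsb2 : u (complexBetti.map (snd E E).hom.hom.hom 1 ω) = s • complexBetti.map (snd E E).hom.hom.hom 1 ω := by
    have h1 := hc' (prodLift (snd E E) (fst E E)) (complexBetti.map (fst E E).hom.hom.hom 1 ω)
    rw [map_swap_map_p₁, hsb, map_smul, map_swap_map_p₁] at h1
    exact h1
  -- `u (p₁^*ω̄) = t • p₁^*ω̄`, `u (p₂^*ω̄) = t • p₂^*ω̄`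
  obtain ⟨t, b', htb⟩ := exists_eq_of_mem_hodgeZeroOne hE hgen' (hpres01 _ hm3)
  have hb' : b' = 0 := by
    have h1 := hc' (prodLift (fst E E) (0 : E.prod E ⟶ E))
      (complexBetti.map (fst E E).hom.hom.hom 1 (conjClass (Motives.ComplexPoints E.X) 1 ω))
    rw [map_e₁₁_map_p₁, htb, map_add, map_smul, map_smul, map_e₁₁_map_p₁, map_e₁₁_map_p₂, smul_zero, add_zero] at h1
    have h2 : b' • complexBetti.map (snd E E).hom.hom.hom 1 (conjClass (Motives.ComplexPoints E.X) 1 ω) = 0 := by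
      have := congrArg (fun y => y - t • complexBetti.map (fst E E).hom.hom.hom 1
        (conjClass (Motives.ComplexPoints E.X) 1 ω)) h1
      rwa [add_sub_cancel_left, sub_self] at this
    have h3 := congrArg (complexBetti.map (prodLift (0 : E ⟶ E) (𝟙 E)).hom.hom.hom 1) h2
    rw [map_smul, map_ι₂_map_p₂, map_zero] at h3
    exact (smul_eq_zero.1 h3).resolve_right hωc0
  rw [hb', zero_smul, add_zero] at htb
  have htb2 : u (complexBetti.map (snd E E).hom.hom.hom 1 (conjClass (Motives.ComplexPoints E.X) 1 ω)) =
      t • complexBetti.map (snd E E).hom.hom.hom 1 (conjClass (Motives.ComplexPoints E.X) 1 ω) := by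
    have h1 := hc' (prodLift (snd E E) (fst E E))
      (complexBetti.map (fst E E).hom.hom.hom 1 (conjClass (Motives.ComplexPoints E.X) 1 ω))
    rw [map_swap_map_p₁, htb, map_smul, map_swap_map_p₁] at h1
    exact h1
  -- `u = s` on `H^{1,0}` and `u = t` on `H^{0,1}`
  have hu10 : ∀ x ∈ hodgeOneZero hXA, u x = s • x := by
    intro x hx
    obtain ⟨a₁, a₂, rfl⟩ := exists_eq_of_mem_hodgeOneZero hE hgen hx
    rw [map_add, map_smul, map_smul, hsb, hsb2, smul_add, smul_smul, smul_smul, smul_smul, smul_smul,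
      mul_comm a₁ s, mul_comm a₂ s]
  have hu01 : ∀ x ∈ hodgeZeroOne hXA, u x = t • x := by
    intro x hx
    obtain ⟨a₁, a₂, rfl⟩ := exists_eq_of_mem_hodgeZeroOne hE hgen' hx
    rw [map_add, map_smul, map_smul, htb, htb2, smul_add, smul_smul, smul_smul, smul_smul, smul_smul,
      mul_comm a₁ t, mul_comm a₂ t]
  -- `s t = 1` from a non-zero pairing `Q(p₁^*ω, y)`
  have hst : s * t = 1 := by
    have hne : complexBetti.map (fst E E).hom.hom.hom 1 ω ≠ 0 := by
      intro h0
      have := congrArg (complexBetti.map (prodLift (𝟙 E) (0 : E ⟶ E)).hom.hom.hom 1) h0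
      rw [map_ι₁_map_p₁, map_zero] at this
      exact hω0 this
    obtain ⟨y, hy⟩ : ∃ y, Q (complexBetti.map (fst E E).hom.hom.hom 1 ω) y ≠ 0 := by
      by_contra hcon
      push Not at hcon
      exact hne (hnd _ hcon)
    have hy' : Q (complexBetti.map (fst E E).hom.hom.hom 1 ω) (projZeroOne hXA y) ≠ 0 := by
      intro h0
      apply hy
      conv_lhs => rw [← projOneZero_add_projZeroOne hXA y]
      rw [map_add, polarizationPairingOne_eq_zero_of_mem_hodgeOneZero hXA hh hm1 (projOneZero_mem hXA y), zero_add, h0]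
    have h1 := hQ (complexBetti.map (fst E E).hom.hom.hom 1 ω) (projZeroOne hXA y)
    rw [hu10 _ hm1, hu01 _ (projZeroOne_mem hXA y), map_smul, map_smul, LinearMap.smul_apply, smul_smul] at h1
    have h2 : (t * s - 1) • Q (complexBetti.map (fst E E).hom.hom.hom 1 ω) (projZeroOne hXA y) = 0 := by
      rw [sub_smul, one_smul, h1, sub_self]
    have h3 := (smul_eq_zero.1 h2).resolve_right hy'
    rw [mul_comm]
    exact (sub_eq_zero.1 h3)
  have hs0 : s ≠ 0 := fun h0 => by rw [h0, zero_mul] at hst; exact zero_ne_one hst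
  have ht : t = s⁻¹ := eq_inv_of_mul_eq_one_right hst
  refine ⟨s, hs0, fun x => ?_⟩
  conv_lhs => rw [← projOneZero_add_projZeroOne hXA x]
  rw [map_add, hu10 _ (projOneZero_mem hXA x), hu01 _ (projZeroOne_mem hXA x), ht]

/-! ### §6 The regular endomorphism `φ = ψ × 2ψ`, the class `h₃`, and `SU(φ, 0, h₃) ⊆` Hodge circle -/

/-- `c • q = q` with `q ≠ 0` forces `c = 1`. [folklore] -/
private theorem eq_one_of_smul_eq_self {M : Type*} [AddCommGroup M] [Module ℂ M] {c : ℂ} {q : M} (h : c • q = q)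
    (hq : q ≠ 0) : c = 1 := by
  have h' : (c - 1) • q = 0 := by rw [sub_smul, one_smul, h, sub_self]
  exact sub_eq_zero.1 ((smul_eq_zero.1 h').resolve_right hq)

/-- `x ⌣ (y ⌣ (a ⌣ c)) = m₄(x, y, a, c)` — the triple cup product of degree-one classes in the spelling produced
by `polarizationPairingOne_eq_cupProduct_cupPowTwo` at `j = 1`, as a value of the iterated product `cupPowOne 4`.
[cite: Hatcher2002, §3.2] -/
theorem cup_cup_cup_eq_cupPowOne {Y : Type} [TopologicalSpace Y] (x y a c : singularCohomology ℂ ℂ Y 1)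
    {e₁ : 1 + 1 = 2} {e₂ : 1 + 2 * 1 = 1 + 2 * 1} {e₃ : 1 + (1 + 2 * 1) = 2 + 2 * 1} :
    cupProduct e₃ x (cupProduct e₂ y (cupProduct e₁ a c)) = cupPowOne ℂ Y 4 ![x, y, a, c] := by
  rw [cupPowOne_succ, cupPowOne_succ, cupPowOne_two]
  rfl

include hψω hψω' in
/-- **`φ^* = (ψ × 2ψ)^*` in coordinates**: `φ^*(a₁ p₁^*ω + a₂ p₂^*ω + c₁ p₁^*ω̄ + c₂ p₂^*ω̄) =
a₁μ p₁^*ω + 2a₂μ p₂^*ω - c₁μ p₁^*ω̄ - 2c₂μ p₂^*ω̄`. [cite: LangeBirkenhake1992, §1.2 and Thm. 4.2.1] -/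
theorem map_Phi_coords (a₁ a₂ c₁ c₂ : ℂ) :
    complexBetti.map (prodLift (fst E E ≫ ψ) (snd E E ≫ (ψ + ψ))).hom.hom.hom 1
        (a₁ • P₁ ω + a₂ • P₂ ω + (c₁ • P₁ ω̄ + c₂ • P₂ ω̄)) =
      (a₁ * μ) • P₁ ω + (a₂ * (μ + μ)) • P₂ ω + ((c₁ * -μ) • P₁ ω̄ + (c₂ * (-μ + -μ)) • P₂ ω̄) := by
  rw [map_add, map_add, map_add, map_smul, map_smul, map_smul, map_smul,
    map_prodMap_map_p₁, map_prodMap_map_p₁, map_prodMap_map_p₂, map_prodMap_map_p₂,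
    complexBetti_map_add_deg_one, complexBetti_map_add_deg_one, hψω, hψω']
  simp only [map_add, map_smul]
  module

include hE hω hω0 hgen hgen' hωc0 hψω hψω' in
/-- **Coordinates of an eigenvector of `φ^* = (ψ × 2ψ)^*`**: if `φ^* x = λ x` then each coordinate of `x` in the
basis `(p₁^*ω, p₂^*ω, p₁^*ω̄, p₂^*ω̄)` is killed by `(eigenvalue - λ)`, the eigenvalues being `μ, 2μ, -μ, -2μ`. [folklore] -/
private theorem eigen_coords {x : complexBetti (E.prod E).X 1} {lam : ℂ}
    (hx : complexBetti.map (prodLift (fst E E ≫ ψ) (snd E E ≫ (ψ + ψ))).hom.hom.hom 1 x = lam • x) :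
    ∃ a₁ a₂ c₁ c₂ : ℂ, x = a₁ • P₁ ω + a₂ • P₂ ω + (c₁ • P₁ ω̄ + c₂ • P₂ ω̄) ∧
      a₁ * (μ - lam) = 0 ∧ a₂ * (μ + μ - lam) = 0 ∧ c₁ * (-μ - lam) = 0 ∧ c₂ * (-μ + -μ - lam) = 0 := by
  obtain ⟨a₁, a₂, c₁, c₂, rfl⟩ := exists_coords hE hgen hgen' x
  refine ⟨a₁, a₂, c₁, c₂, rfl, ?_⟩
  rw [map_Phi_coords hψω hψω'] at hx
  have h0 : (a₁ * (μ - lam)) • P₁ ω + (a₂ * (μ + μ - lam)) • P₂ ω +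
      ((c₁ * (-μ - lam)) • P₁ ω̄ + (c₂ * (-μ + -μ - lam)) • P₂ ω̄) = 0 := by
    have h1 := sub_eq_zero.2 hx
    rw [← h1]
    module
  exact coords_eq_zero hE hω hω0 hωc0 h0

include hE hω hω0 hgen hgen' hωc0 hψω hψω' hμ0 in
/-- **`φ^* = (ψ × 2ψ)^*` is injective on `H¹(E × E)`** (its eigenvalues `± μ, ± 2μ` are non-zero).
[cite: LangeBirkenhake1992, §1.2] -/
theorem pullback_Phi_injective :
    Function.Injective (complexBetti.map (prodLift (fst E E ≫ ψ) (snd E E ≫ (ψ + ψ))).hom.hom.hom 1) := by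
  refine (injective_iff_map_eq_zero _).2 fun x hx => ?_
  have hx' : complexBetti.map (prodLift (fst E E ≫ ψ) (snd E E ≫ (ψ + ψ))).hom.hom.hom 1 x = (0 : ℂ) • x := by
    rw [zero_smul]; exact hx
  obtain ⟨a₁, a₂, c₁, c₂, rfl, h1, h2, h3, h4⟩ := eigen_coords hE hω hω0 hgen hgen' hωc0 hψω hψω' hx'
  have hμ2 : μ + μ ≠ 0 := fun h => hμ0 (by linear_combination h / 2)
  have hμ3 : -μ ≠ 0 := neg_ne_zero.2 hμ0
  have hμ4 : -μ + -μ ≠ 0 := fun h => hμ0 (by linear_combination -h / 2)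
  rw [sub_zero] at h1 h2 h3 h4
  rw [(mul_eq_zero.1 h1).resolve_right hμ0, (mul_eq_zero.1 h2).resolve_right hμ2,
    (mul_eq_zero.1 h3).resolve_right hμ3, (mul_eq_zero.1 h4).resolve_right hμ4]
  simp only [zero_smul, add_zero]

include hE hω in
/-- **The class `h₃ = (p₁^*ω + p₂^*ω) ⌣ (p₁^*ω̄ + p₂^*ω̄)` is of type `(1,1)`.** [cite: VoisinHodgeI2002, §7.1.2] -/
theorem isOfHodgeType_h₃ :
    IsOfHodgeType (1 + 1) (E.prod E).X 2 1 1 (cupProduct (rfl : 1 + 1 = 2) (P₁ ω + P₂ ω) (P₁ ω̄ + P₂ ω̄)) := by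
  have hXA := Motives.isSmoothProjective_of_dim_eq' (dim_sq hE)
  have hcup : CupPreservesHodgeType (1 + 1) (E.prod E).X :=
    cupPreservesHodgeType_of_multiplicative_deRham
      (fun V _ _ _ => Literature.NumberTheory.Transcendental.exists_deRhamIsoFamily_holds V) hXA
  obtain ⟨h1, h2⟩ := map_p_mem_hodgeOneZero hE hω
  obtain ⟨h3, h4⟩ := map_p_conj_mem_hodgeZeroOne hE hω
  have hα : IsOfHodgeType (1 + 1) (E.prod E).X 1 1 0 (P₁ ω + P₂ ω) :=
    (mem_hodgeOneZero hXA).1 (Submodule.add_mem _ h1 h2)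
  have hβ : IsOfHodgeType (1 + 1) (E.prod E).X 1 0 1 (P₁ ω̄ + P₂ ω̄) :=
    (mem_hodgeZeroOne hXA).1 (Submodule.add_mem _ h3 h4)
  exact hcup rfl hα hβ

include hE hω hω0 hωc0 in
/-- **The four cross pairings of `h₃` are non-zero**: `Q_{h₃}(pᵢ^*ω, pⱼ^*ω̄) = ± p₁^*ω ⌣ p₂^*ω ⌣ p₁^*ω̄ ⌣ p₂^*ω̄ ≠ 0`
for `i, j ∈ {1, 2}` (the complementary monomial survives; the top product of a basis of `H¹` is non-zero,
`H• = ⋀•H¹`). [cite: LangeBirkenhake1992, Lemma 1.1.17 and Exercise 1.1.6 (7)] [cite: Hatcher2002, §3.2] -/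
theorem polarizationPairingOne_h₃_ne_zero :
    let Q := polarizationPairingOne (E.prod E).X (cupProduct (rfl : 1 + 1 = 2) (P₁ ω + P₂ ω) (P₁ ω̄ + P₂ ω̄)) 1
    Q (P₁ ω) (P₁ ω̄) ≠ 0 ∧ Q (P₁ ω) (P₂ ω̄) ≠ 0 ∧ Q (P₂ ω) (P₁ ω̄) ≠ 0 ∧ Q (P₂ ω) (P₂ ω̄) ≠ 0 := by
  intro Q
  have hli := linearIndependent_basis hE hω hω0 hωc0
  -- the expansion `Q x y = Σ_{k,l} m₄(x, y, bₖ, b_l)`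
  have hexp : ∀ x y, Q x y = cupPowOne ℂ _ 4 ![x, y, P₁ ω, P₁ ω̄] + cupPowOne ℂ _ 4 ![x, y, P₁ ω, P₂ ω̄] +
      (cupPowOne ℂ _ 4 ![x, y, P₂ ω, P₁ ω̄] + cupPowOne ℂ _ 4 ![x, y, P₂ ω, P₂ ω̄]) := by
    intro x y
    show polarizationPairingOne (E.prod E).X _ 1 x y = _
    rw [polarizationPairingOne_eq_cupProduct_cupPowTwo, cupPowTwo_one]
    simp only [map_add, LinearMap.add_apply]
    rw [cup_cup_cup_eq_cupPowOne, cup_cup_cup_eq_cupPowOne, cup_cup_cup_eq_cupPowOne, cup_cup_cup_eq_cupPowOne]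
    abel
  -- non-vanishing of a permuted top product
  have hne : ∀ σ : Fin 4 → Fin 4, Function.Injective σ →
      cupPowOne ℂ (Motives.ComplexPoints (E.prod E).X) 4 (![P₁ ω, P₂ ω, P₁ ω̄, P₂ ω̄] ∘ σ) ≠ 0 :=
    fun σ hσ => cupPowOne_ne_zero_of_linearIndependent (E.prod E) (hli.comp σ hσ)
  have z : ∀ (v : Fin 4 → complexBetti (E.prod E).X 1) (i j : Fin 4), v i = v j → i ≠ j →
      cupPowOne ℂ (Motives.ComplexPoints (E.prod E).X) 4 v = 0 :=
    fun v i j hv hij => cupPowOne_eq_zero_of_eq 4 v i j hv hij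
  refine ⟨?_, ?_, ?_, ?_⟩
  · rw [hexp, z ![P₁ ω, P₁ ω̄, P₁ ω, P₁ ω̄] 0 2 rfl (by decide), z ![P₁ ω, P₁ ω̄, P₁ ω, P₂ ω̄] 0 2 rfl (by decide),
      z ![P₁ ω, P₁ ω̄, P₂ ω, P₁ ω̄] 1 3 rfl (by decide)]
    simp only [zero_add]
    have h := hne ![0, 2, 1, 3] (by decide)
    have e : (![P₁ ω, P₂ ω, P₁ ω̄, P₂ ω̄] ∘ ![(0 : Fin 4), 2, 1, 3]) = ![P₁ ω, P₁ ω̄, P₂ ω, P₂ ω̄] := by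
      funext i; fin_cases i <;> rfl
    rwa [e] at h
  · rw [hexp, z ![P₁ ω, P₂ ω̄, P₁ ω, P₁ ω̄] 0 2 rfl (by decide), z ![P₁ ω, P₂ ω̄, P₁ ω, P₂ ω̄] 0 2 rfl (by decide),
      z ![P₁ ω, P₂ ω̄, P₂ ω, P₂ ω̄] 1 3 rfl (by decide)]
    simp only [zero_add, add_zero]
    have h := hne ![0, 3, 1, 2] (by decide)
    have e : (![P₁ ω, P₂ ω, P₁ ω̄, P₂ ω̄] ∘ ![(0 : Fin 4), 3, 1, 2]) = ![P₁ ω, P₂ ω̄, P₂ ω, P₁ ω̄] := by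
      funext i; fin_cases i <;> rfl
    rwa [e] at h
  · rw [hexp, z ![P₂ ω, P₁ ω̄, P₁ ω, P₁ ω̄] 1 3 rfl (by decide), z ![P₂ ω, P₁ ω̄, P₂ ω, P₁ ω̄] 0 2 rfl (by decide),
      z ![P₂ ω, P₁ ω̄, P₂ ω, P₂ ω̄] 0 2 rfl (by decide)]
    simp only [zero_add, add_zero]
    have h := hne ![1, 2, 0, 3] (by decide)
    have e : (![P₁ ω, P₂ ω, P₁ ω̄, P₂ ω̄] ∘ ![(1 : Fin 4), 2, 0, 3]) = ![P₂ ω, P₁ ω̄, P₁ ω, P₂ ω̄] := by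
      funext i; fin_cases i <;> rfl
    rwa [e] at h
  · rw [hexp, z ![P₂ ω, P₂ ω̄, P₁ ω, P₂ ω̄] 1 3 rfl (by decide), z ![P₂ ω, P₂ ω̄, P₂ ω, P₁ ω̄] 0 2 rfl (by decide),
      z ![P₂ ω, P₂ ω̄, P₂ ω, P₂ ω̄] 0 2 rfl (by decide)]
    simp only [add_zero]
    have h := hne ![1, 3, 0, 2] (by decide)
    have e : (![P₁ ω, P₂ ω, P₁ ω̄, P₂ ω̄] ∘ ![(1 : Fin 4), 3, 0, 2]) = ![P₂ ω, P₂ ω̄, P₁ ω, P₁ ω̄] := by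
      funext i; fin_cases i <;> rfl
    rwa [e] at h

include hE hω hω0 hgen hgen' hωc0 hψω hψω' hμ0 in
/-- **`SU(φ, 0, h₃) ⊆` Hodge circle**: an automorphism of `H¹(E × E)` commuting with `φ^* = (ψ × 2ψ)^*` (four
distinct eigenvalues: it is diagonal in the basis `bᵢ`, `u bᵢ = sᵢ bᵢ`) and preserving `Q_{h₃}` (all four cross
pairings non-zero: `s₀s₂ = s₀s₃ = s₁s₂ = s₁s₃ = 1`) is `z · π^{1,0} + z⁻¹ · π^{0,1}` with `z = s₀ = s₁`. The
determinant clauses (eigenvalue `± i√0 = 0`) are not used. [cite: vanGeemen1994HodgeAV, 6.9 and Lemma 6.10] -/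
theorem exists_circle_of_mem_weilSpecialUnitaryGroup {u : complexBetti (E.prod E).X 1 ≃ₗ[ℂ] complexBetti (E.prod E).X 1}
    (hu : u ∈ weilSpecialUnitaryGroup (E.prod E) (prodLift (fst E E ≫ ψ) (snd E E ≫ (ψ + ψ))) 1 0
      (cupProduct (rfl : 1 + 1 = 2) (P₁ ω + P₂ ω) (P₁ ω̄ + P₂ ω̄))) :
    ∃ z : ℂ, z ≠ 0 ∧ ∀ x, u x = z • projOneZero (Motives.isSmoothProjective_of_dim_eq' (dim_sq hE)) x +
      z⁻¹ • projZeroOne (Motives.isSmoothProjective_of_dim_eq' (dim_sq hE)) x := by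
  have hXA := Motives.isSmoothProjective_of_dim_eq' (dim_sq hE)
  obtain ⟨hc, hQ', -, -⟩ := mem_weilSpecialUnitaryGroup_iff.1 hu
  set Q := polarizationPairingOne (E.prod E).X (cupProduct (rfl : 1 + 1 = 2) (P₁ ω + P₂ ω) (P₁ ω̄ + P₂ ω̄)) 1
    with hQdef
  have hQ : ∀ x y, Q (u x) (u y) = Q x y := fun x y => hQ' x y
  obtain ⟨q₁₁, q₁₂, q₂₁, q₂₂⟩ := polarizationPairingOne_h₃_ne_zero hE hω hω0 hωc0
  have hc' : ∀ x, u (complexBetti.map (prodLift (fst E E ≫ ψ) (snd E E ≫ (ψ + ψ))).hom.hom.hom 1 x) =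
      complexBetti.map (prodLift (fst E E ≫ ψ) (snd E E ≫ (ψ + ψ))).hom.hom.hom 1 (u x) := hc
  -- eigenvalue equations for the images of the basis vectors
  have hev : ∀ {x : complexBetti (E.prod E).X 1} {lam : ℂ},
      complexBetti.map (prodLift (fst E E ≫ ψ) (snd E E ≫ (ψ + ψ))).hom.hom.hom 1 x = lam • x →
      complexBetti.map (prodLift (fst E E ≫ ψ) (snd E E ≫ (ψ + ψ))).hom.hom.hom 1 (u x) = lam • u x := by
    intro x lam hx
    rw [← hc', hx, map_smul]
  have hb0 : complexBetti.map (prodLift (fst E E ≫ ψ) (snd E E ≫ (ψ + ψ))).hom.hom.hom 1 (P₁ ω) = μ • P₁ ω := by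
    have h := map_Phi_coords hψω hψω' 1 0 0 0
    simp only [one_smul, zero_smul, add_zero, one_mul, zero_mul] at h
    exact h
  have hb1 : complexBetti.map (prodLift (fst E E ≫ ψ) (snd E E ≫ (ψ + ψ))).hom.hom.hom 1 (P₂ ω) = (μ + μ) • P₂ ω := by
    have h := map_Phi_coords hψω hψω' 0 1 0 0
    simp only [one_smul, zero_smul, add_zero, zero_add, one_mul, zero_mul] at h
    exact h
  have hb2 : complexBetti.map (prodLift (fst E E ≫ ψ) (snd E E ≫ (ψ + ψ))).hom.hom.hom 1 (P₁ ω̄) = (-μ) • P₁ ω̄ := by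
    have h := map_Phi_coords hψω hψω' 0 0 1 0
    simp only [one_smul, zero_smul, add_zero, zero_add, one_mul, zero_mul] at h
    exact h
  have hb3 : complexBetti.map (prodLift (fst E E ≫ ψ) (snd E E ≫ (ψ + ψ))).hom.hom.hom 1 (P₂ ω̄) =
      (-μ + -μ) • P₂ ω̄ := by
    have h := map_Phi_coords hψω hψω' 0 0 0 1
    simp only [one_smul, zero_smul, zero_add, one_mul, zero_mul] at h
    exact h
  -- `u bᵢ = sᵢ bᵢ`
  obtain ⟨s₀, a₂, c₁, c₂, hu0, -, h2, h3, h4⟩ := eigen_coords hE hω hω0 hgen hgen' hωc0 hψω hψω' (hev hb0)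
  have e2 : a₂ = 0 := (mul_eq_zero.1 h2).resolve_right (fun h => hμ0 (by linear_combination h))
  have e3 : c₁ = 0 := (mul_eq_zero.1 h3).resolve_right (fun h => hμ0 (by linear_combination -h / 2))
  have e4 : c₂ = 0 := (mul_eq_zero.1 h4).resolve_right (fun h => hμ0 (by linear_combination -h / 3))
  rw [e2, e3, e4, zero_smul, zero_smul, zero_smul, add_zero, add_zero, add_zero] at hu0
  obtain ⟨a₁, s₁, c₁', c₂', hu1, h1, -, h3', h4'⟩ := eigen_coords hE hω hω0 hgen hgen' hωc0 hψω hψω' (hev hb1)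
  have e1 : a₁ = 0 := (mul_eq_zero.1 h1).resolve_right (fun h => hμ0 (by linear_combination -h))
  have e3' : c₁' = 0 := (mul_eq_zero.1 h3').resolve_right (fun h => hμ0 (by linear_combination -h / 3))
  have e4' : c₂' = 0 := (mul_eq_zero.1 h4').resolve_right (fun h => hμ0 (by linear_combination -h / 4))
  rw [e1, e3', e4', zero_smul, zero_smul, zero_smul, zero_add, add_zero, add_zero] at hu1
  obtain ⟨a₁', a₂', s₂, c₂'', hu2, h1', h2', -, h4''⟩ := eigen_coords hE hω hω0 hgen hgen' hωc0 hψω hψω' (hev hb2)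
  have f1 : a₁' = 0 := (mul_eq_zero.1 h1').resolve_right (fun h => hμ0 (by linear_combination h / 2))
  have f2 : a₂' = 0 := (mul_eq_zero.1 h2').resolve_right (fun h => hμ0 (by linear_combination h / 3))
  have f4 : c₂'' = 0 := (mul_eq_zero.1 h4'').resolve_right (fun h => hμ0 (by linear_combination -h))
  rw [f1, f2, f4, zero_smul, zero_smul, zero_smul, zero_add, add_zero, zero_add] at hu2
  obtain ⟨a₁'', a₂'', c₁'', s₃, hu3, h1'', h2'', h3'', -⟩ := eigen_coords hE hω hω0 hgen hgen' hωc0 hψω hψω' (hev hb3)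
  have g1 : a₁'' = 0 := (mul_eq_zero.1 h1'').resolve_right (fun h => hμ0 (by linear_combination h / 3))
  have g2 : a₂'' = 0 := (mul_eq_zero.1 h2'').resolve_right (fun h => hμ0 (by linear_combination h / 4))
  have g3 : c₁'' = 0 := (mul_eq_zero.1 h3'').resolve_right (fun h => hμ0 (by linear_combination h))
  rw [g1, g2, g3, zero_smul, zero_smul, zero_smul, zero_add, zero_add, zero_add] at hu3
  -- the relations `sᵢ sⱼ = 1`
  have r02 : s₂ * s₀ = 1 := by
    have h := hQ (P₁ ω) (P₁ ω̄)
    rw [hu0, hu2, map_smul, map_smul, LinearMap.smul_apply, smul_smul] at h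
    exact eq_one_of_smul_eq_self h q₁₁
  have r03 : s₃ * s₀ = 1 := by
    have h := hQ (P₁ ω) (P₂ ω̄)
    rw [hu0, hu3, map_smul, map_smul, LinearMap.smul_apply, smul_smul] at h
    exact eq_one_of_smul_eq_self h q₁₂
  have r12 : s₂ * s₁ = 1 := by
    have h := hQ (P₂ ω) (P₁ ω̄)
    rw [hu1, hu2, map_smul, map_smul, LinearMap.smul_apply, smul_smul] at h
    exact eq_one_of_smul_eq_self h q₂₁
  have hs0 : s₀ ≠ 0 := fun h0 => by rw [h0, mul_zero] at r02; exact zero_ne_one r02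
  have hs2 : s₂ = s₀⁻¹ := eq_inv_of_mul_eq_one_left r02
  have hs3 : s₃ = s₀⁻¹ := eq_inv_of_mul_eq_one_left r03
  have hs1 : s₁ = s₀ := by
    have h : s₂ * s₁ = s₂ * s₀ := by rw [r12, r02]
    exact mul_left_cancel₀ (by rw [hs2]; exact inv_ne_zero hs0) h
  -- conclusion
  have hu10 : ∀ x ∈ hodgeOneZero hXA, u x = s₀ • x := by
    intro x hx
    obtain ⟨a, b, rfl⟩ := exists_eq_of_mem_hodgeOneZero hE hgen hx
    rw [map_add, map_smul, map_smul, hu0, hu1, hs1, smul_add, smul_smul, smul_smul, smul_smul, smul_smul,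
      mul_comm a s₀, mul_comm b s₀]
  have hu01 : ∀ x ∈ hodgeZeroOne hXA, u x = s₀⁻¹ • x := by
    intro x hx
    obtain ⟨a, b, rfl⟩ := exists_eq_of_mem_hodgeZeroOne hE hgen' hx
    rw [map_add, map_smul, map_smul, hu2, hu3, hs2, hs3, smul_add, smul_smul, smul_smul, smul_smul, smul_smul,
      mul_comm a s₀⁻¹, mul_comm b s₀⁻¹]
  refine ⟨s₀, hs0, fun x => ?_⟩
  conv_lhs => rw [← projOneZero_add_projZeroOne hXA x]
  rw [map_add, hu10 _ (projOneZero_mem hXA x), hu01 _ (projZeroOne_mem hXA x)]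

end CM

/-! ### §7 `B• = D•` on the powers of `E × E`, Milne's `Hg(E × E)|_{H¹} = U(C)(h_K)`, and the Hodge circle -/

section Assembly

variable {ψ : E ⟶ E} {d₀ : ℕ} (hd₀ : 0 < d₀) (hψ : ψ ≫ ψ = -(d₀ • 𝟙 E)) {μ : ℂ}
  (hψω : complexBetti.map ψ.hom.hom.hom 1 ω = μ • ω)
  (hψω' : complexBetti.map ψ.hom.hom.hom 1 (conjClass (Motives.ComplexPoints E.X) 1 ω) =
    (-μ) • conjClass (Motives.ComplexPoints E.X) 1 ω)
  (hμ0 : μ ≠ 0)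

include hE hd₀ hψ in
/-- **`B• = D•` on every power `(E × E)^{N+1}` of the square of a CM elliptic curve** (Tate, Murasaki;
van Geemen 4.3; Moonen–Zarhin §2, `g = 1`): every `(1,0)`-class of `(E × E)^{N+1}` is a combination of
pull-backs `g^*w` of `(1,0)`-classes of `E` along homomorphisms `g : (E × E)^{N+1} → E` (Künneth in degree
one, by induction on `N`), so the tree's `EllipticCurve.hodgeClasses_divisorial_of_hodgeOneZero_mem_span_pullback`
(the CM case of the divisor theorem for powers of an elliptic curve) applies.
[cite: vanGeemen1994HodgeAV, Thm. 4.3] [cite: MoonenZarhin1999LowDim, §2] [cite: LangeBirkenhake1992, Thm. 4.2.1] -/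
theorem isDivisorGenerated_powSucc (N : ℕ) : IsDivisorGenerated ((E.prod E).powSucc N) := by
  have hgen2 := AbelianVariety.hodgeOneZero_mem_span_pullback_prod E E E
    (AbelianVariety.hodgeOneZero_mem_span_pullback_self E) (AbelianVariety.hodgeOneZero_mem_span_pullback_self E)
  have key : ∀ M : ℕ, ∀ u : complexBetti ((E.prod E).powSucc M).X 1,
      IsOfHodgeType ((E.prod E).powSucc M).dim ((E.prod E).powSucc M).X 1 1 0 u →
        u ∈ Submodule.span ℂ {y : complexBetti ((E.prod E).powSucc M).X 1 |
          ∃ (g : (E.prod E).powSucc M ⟶ E) (w : complexBetti E.X 1),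
            IsOfHodgeType E.dim E.X 1 1 0 w ∧ y = complexBetti.map g.hom.hom.hom 1 w} := by
    intro M
    induction M with
    | zero => exact hgen2
    | succ M ih => exact AbelianVariety.hodgeOneZero_mem_span_pullback_prod E _ _ ih hgen2
  exact fun p c hcQ hc =>
    EllipticCurve.hodgeClasses_divisorial_of_hodgeOneZero_mem_span_pullback hE ψ hd₀ hψ _ (key N) p c hcQ hc

/-- **A projective embedding of `E × E` and a non-zero rational class in `H²` of the ambient projective
space** (the hyperplane class; `H²(ℙᴺ; ℂ) = ℂ` is spanned by rational classes). [cite: VoisinHodgeI2002, §7.1.2 and §11.3.2] -/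
theorem exists_embedding_rationalClass (hE : E.dim = 1) :
    ∃ (e : Motives.ProjectiveEmbedding (E.prod E).X) (a : complexBetti (Motives.projectiveSpace e.n ℂ) 2),
      IsRationalClass a ∧ a ≠ 0 := by
  have hA2 : (E.prod E).dim = 2 * 1 := by rw [dim_sq hE]
  have hX : IsSmoothProjective (2 * 1) (E.prod E).X := Motives.isSmoothProjective_of_dim_eq' hA2
  let e : Motives.ProjectiveEmbedding (E.prod E).X := hX.isProjectiveOver.projectiveEmbedding
  have hN : 1 ≤ e.n := le_trans (by norm_num) (le_of_isClosedImmersion_projectiveSpace hX e.ι)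
  have hP : IsSmoothProjective e.n (Motives.projectiveSpace e.n ℂ) := isSmoothProjective_projectiveSpace' e.n
  have h1 : Module.finrank ℂ (complexBetti (Motives.projectiveSpace e.n ℂ) 2) = 1 :=
    finrank_complexBetti_projectiveSpace_two_mul_eq_one e.n (p := 1) hN
  have hspan := span_isRationalClass_eq_top_of_isSmoothProjective_holds e.n (Motives.projectiveSpace e.n ℂ) hP 2
  by_contra hcon
  have hbot : Submodule.span ℂ {c : complexBetti (Motives.projectiveSpace e.n ℂ) 2 | IsRationalClass c} = ⊥ :=
    Submodule.span_eq_bot.2 fun c hc => by_contra fun h0 => hcon ⟨e, c, hc, h0⟩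
  rw [hspan] at hbot
  haveI : Subsingleton (complexBetti (Motives.projectiveSpace e.n ℂ) 2) :=
    subsingleton_of_forall_eq 0 fun c => (Submodule.mem_bot ℂ).1 (hbot ▸ Submodule.mem_top)
  rw [Module.finrank_zero_of_subsingleton] at h1
  exact zero_ne_one h1

include hE hd₀ hψ in
/-- **Milne 1999, Thm. 4.4 for the CM square**: `Hg(E × E)(ℂ)|_{H¹} = S(E × E)(ℂ) = U(C)(h_K)` for the rational
`(1,1)`-class `h_K = e^*a + 𝟙^*e^*a` (a non-zero real multiple of a Kähler class) of any projective embedding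
`e` and any non-zero rational `a ∈ H²(ℙᴺ)`, because `B• = D•` on all powers of `E × E`
(`isDivisorGenerated_powSucc`). [cite: Milne1999LefschetzClasses, Thm. 4.4 and Prop. 4.8] -/
theorem hodgeGroupOne_eq_unitaryCentralizerGroup (e : Motives.ProjectiveEmbedding (E.prod E).X)
    {a : complexBetti (Motives.projectiveSpace e.n ℂ) 2} (ha : IsRationalClass a) (ha0 : a ≠ 0) :
    hodgeGroupOne (E.prod E).dim (E.prod E).X = Milne1999.unitaryCentralizerGroup (E.prod E)
      (((1 : ℕ) : ℂ) • complexBetti.map e.ι 2 a +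
        complexBetti.map (𝟙 (E.prod E) : E.prod E ⟶ E.prod E).hom.hom.hom 2 (complexBetti.map e.ι 2 a)) := by
  have hA : (E.prod E).dim = 1 + 1 := dim_sq hE
  obtain ⟨s, H', hs, hH', hsH⟩ := exists_isKaehlerClass_ksymm_eq_smul hA one_pos (𝟙 (E.prod E)) e ha ha0
  set hK := ((1 : ℕ) : ℂ) • complexBetti.map e.ι 2 a +
    complexBetti.map (𝟙 (E.prod E) : E.prod E ⟶ E.prod E).hom.hom.hom 2 (complexBetti.map e.ι 2 a) with hKdef
  have hKrat : IsRationalClass hK := isRationalClass_ksymm 1 (𝟙 (E.prod E)) e ha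
  have hdiv : ∀ N, IsDivisorGenerated ((E.prod E).powSucc N) := isDivisorGenerated_powSucc hE hd₀ hψ
  rcases lt_or_gt_of_ne hs with hneg | hpos
  · -- `s < 0`: use `-h_K`, a positive multiple of a Kähler class; `U(C)(-h_K) = U(C)(h_K)`
    have hKrat' : IsRationalClass (-hK) := by
      have h := hKrat.smul (-1)
      rwa [Rat.cast_neg, Rat.cast_one, neg_one_smul] at h
    have hc : (((-s)⁻¹ : ℝ) : ℂ) * (s : ℂ) = -1 := by
      rw [← Complex.ofReal_mul, ← neg_inv, neg_mul, inv_mul_cancel₀ hs, Complex.ofReal_neg, Complex.ofReal_one]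
    have hKneg : ∃ s' : ℝ, 0 < s' ∧ IsKaehlerClass (E.prod E).dim (E.prod E).X ((s' : ℂ) • -hK) := by
      refine ⟨(-s)⁻¹, inv_pos.2 (neg_pos.2 hneg), ?_⟩
      rw [hA, hsH, smul_neg, smul_smul, hc, neg_one_smul, neg_neg]
      exact hH'
    have hU : Milne1999.unitaryCentralizerGroup (E.prod E) (-hK) =
        Milne1999.unitaryCentralizerGroup (E.prod E) hK := by
      rw [← neg_one_smul ℂ hK]
      exact Milne1999.unitaryCentralizerGroup_smul (by norm_num) hK
    rw [Milne1999.hodgeGroupOne_eq_unitaryCentralizerGroup_of_forall_isDivisorGenerated' hKrat' hKneg hdiv, hU]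
  · have hc : ((s⁻¹ : ℝ) : ℂ) * (s : ℂ) = 1 := by
      rw [← Complex.ofReal_mul, inv_mul_cancel₀ hs, Complex.ofReal_one]
    have hKpos : ∃ s' : ℝ, 0 < s' ∧ IsKaehlerClass (E.prod E).dim (E.prod E).X ((s' : ℂ) • hK) := by
      refine ⟨s⁻¹, inv_pos.2 hpos, ?_⟩
      rw [hA, hsH, smul_smul, hc, one_smul]
      exact hH'
    exact Milne1999.hodgeGroupOne_eq_unitaryCentralizerGroup_of_forall_isDivisorGenerated' hKrat hKpos hdiv

include hE hω hω0 hgen hgen' hωc0 hd₀ hψ hψω hψω' hμ0 in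
/-- **`Hg(E × E)(ℂ)|_{H¹}` is the Hodge circle** `{z · π^{1,0} + z⁻¹ · π^{0,1} : z ∈ ℂˣ}` for an elliptic
curve `E` with complex multiplication (Gordon 2.12, Moonen–Zarhin §2: `Hg(E × E) ≅ Hg(E) = U(1)`, whose
complex points `z` act on `H^{1,0}` by `z` and on `H^{0,1}` by `z⁻¹`). Proof: Milne's
`Hg|_{H¹} = U(C)(h_K)` (`hodgeGroupOne_eq_unitaryCentralizerGroup`), `U(C)(h_K) ⊆` circle
(`exists_circle_of_mem_unitaryCentralizerGroup`; `Q_{h_K}` is non-degenerate by hard Lefschetz) and circle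
`⊆ U(C)(h_K)` (`mem_unitaryCentralizerGroup_of_circle`). [cite: Gordon1999HodgeAVSurvey, 2.12 Proposition]
[cite: MoonenZarhin1999LowDim, §2] [cite: Milne1999LefschetzClasses, Thm. 4.4] -/
theorem mem_hodgeGroupOne_iff_circle {u : complexBetti (E.prod E).X 1 ≃ₗ[ℂ] complexBetti (E.prod E).X 1} :
    u ∈ hodgeGroupOne (E.prod E).dim (E.prod E).X ↔
      ∃ z : ℂ, z ≠ 0 ∧ ∀ x, u x = z • projOneZero (Motives.isSmoothProjective_of_dim_eq' (dim_sq hE)) x +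
        z⁻¹ • projZeroOne (Motives.isSmoothProjective_of_dim_eq' (dim_sq hE)) x := by
  have hA : (E.prod E).dim = 1 + 1 := dim_sq hE
  have hXA := Motives.isSmoothProjective_of_dim_eq' hA
  obtain ⟨e, a, ha, ha0⟩ := exists_embedding_rationalClass hE
  set hK := ((1 : ℕ) : ℂ) • complexBetti.map e.ι 2 a +
    complexBetti.map (𝟙 (E.prod E) : E.prod E ⟶ E.prod E).hom.hom.hom 2 (complexBetti.map e.ι 2 a) with hKdef
  have h11 : IsOfHodgeType (1 + 1) (E.prod E).X 2 1 1 hK :=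
    isOfHodgeType_one_one_ksymm hA one_pos (𝟙 (E.prod E)) e ha ha0
  -- non-degeneracy of `Q_{h_K}` on `H¹` (hard Lefschetz for a multiple of a Kähler class)
  have hHL : Literature.Geometry.Kaehler.HasHardLefschetzProperty hK (E.prod E).dim := by
    obtain ⟨s, H', hs, hH', hsH⟩ := exists_isKaehlerClass_ksymm_eq_smul hA one_pos (𝟙 (E.prod E)) e ha ha0
    rw [hA]
    have h1 : Literature.Geometry.Kaehler.HasHardLefschetzProperty H' (1 + 1) :=
      hH'.hasHardLefschetzProperty hXA fun _ => Motives.hasHardLefschetzProperty_kaehlerClass_holds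
    have h2 := HasHardLefschetzProperty.smul h1 (Complex.ofReal_ne_zero.2 hs)
    rwa [← hsH] at h2
  have hnd : ∀ x : complexBetti (E.prod E).X 1,
      (∀ y, polarizationPairingOne (E.prod E).X hK 1 x y = 0) → x = 0 := by
    intro x hx
    refine Milne1999.eq_zero_of_forall_polarizationPairingOne_eq_zero_of_hasHardLefschetzProperty
      (A := E.prod E) (by rw [hA]; omega) hHL fun y => ?_
    have key : ∀ j, j = 1 → polarizationPairingOne (E.prod E).X hK j x y = 0 := by
      intro j hj; subst hj; exact hx y
    exact key ((E.prod E).dim - 1) (by rw [hA])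
  rw [hodgeGroupOne_eq_unitaryCentralizerGroup hE hd₀ hψ e ha ha0]
  constructor
  · exact fun hu =>
      exists_circle_of_mem_unitaryCentralizerGroup hE hω hω0 hgen hgen' hωc0 hψω hψω' hμ0 h11 hnd hu
  · rintro ⟨z, hz, hu⟩
    exact mem_unitaryCentralizerGroup_of_circle hE hz hu h11

include hE hω hω0 hgen hgen' hωc0 hd₀ hψ hψω hψω' hμ0 in
/-- **`HasHodgeGroupSU (E × E) (ψ × 2ψ) 1 0 h₃` holds** for a CM elliptic curve `E`: with `n = 1`, the
regular endomorphism `φ = ψ × 2ψ`, `d = 0` and the `(1,1)`-class `h₃ = (p₁^*ω + p₂^*ω) ⌣ (p₁^*ω̄ + p₂^*ω̄)`,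
van Geemen's group `SU_H(ℂ) = weilSpecialUnitaryGroup (E × E) φ 1 0 h₃` is the Hodge circle
(`exists_circle_of_mem_weilSpecialUnitaryGroup`, `mem_weilSpecialUnitaryGroup_of_circle`), and so is
`Hg(E × E)(ℂ)|_{H¹}` (`mem_hodgeGroupOne_iff_circle`). The data `(φ, 0, h₃)` are NOT of Weil type
(`φ ≫ φ ≠ -d`, `d = 0`, `h₃ ≠ d·e^*a + φ^*e^*a`). [cite: vanGeemen1994HodgeAV, 6.9–6.11 and 5.3]
[cite: Gordon1999HodgeAVSurvey, 2.12 Proposition] -/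
theorem hasHodgeGroupSU :
    HasHodgeGroupSU (E.prod E) (prodLift (fst E E ≫ ψ) (snd E E ≫ (ψ + ψ))) 1 0
      (cupProduct (rfl : 1 + 1 = 2) (P₁ ω + P₂ ω) (P₁ ω̄ + P₂ ω̄)) := by
  refine hasHodgeGroupSU_iff.2 (Subgroup.ext fun u => ?_)
  rw [mem_hodgeGroupOne_iff_circle hE hω hω0 hgen hgen' hωc0 hd₀ hψ hψω hψω' hμ0]
  constructor
  · rintro ⟨z, hz, hu⟩
    exact mem_weilSpecialUnitaryGroup_of_circle hE hz hu (isOfHodgeType_h₃ hE hω) _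
      (pullback_Phi_injective hE hω hω0 hgen hgen' hωc0 hψω hψω' hμ0)
  · exact fun hu => exists_circle_of_mem_weilSpecialUnitaryGroup hE hω hω0 hgen hgen' hωc0 hψω hψω' hμ0 hu

/-! ### §8 `Hg(E × E)` is commutative and infinite: `¬ HasSemisimpleHodgeGroup (E × E)` -/

/-- **The Hodge circle consists of automorphisms**: for `z ≠ 0`, `z · π^{1,0} + z⁻¹ · π^{0,1}` is a linear
automorphism of `H¹(E × E)` (inverse: `z⁻¹ · π^{1,0} + z · π^{0,1}`). [cite: VoisinHodgeI2002, §6.1.3 Cor. 6.14] -/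
theorem exists_circle_linearEquiv (hE : E.dim = 1) {z : ℂ} (hz : z ≠ 0) :
    ∃ u : complexBetti (E.prod E).X 1 ≃ₗ[ℂ] complexBetti (E.prod E).X 1,
      ∀ x, u x = z • projOneZero (Motives.isSmoothProjective_of_dim_eq' (dim_sq hE)) x +
        z⁻¹ • projZeroOne (Motives.isSmoothProjective_of_dim_eq' (dim_sq hE)) x := by
  set hXA := Motives.isSmoothProjective_of_dim_eq' (dim_sq hE) with hXAdef
  have e1 : ∀ y, projOneZero hXA (projOneZero hXA y) = projOneZero hXA y := fun y =>
    projOneZero_of_mem_hodgeOneZero hXA (projOneZero_mem hXA y)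
  have e2 : ∀ y, projZeroOne hXA (projOneZero hXA y) = 0 := fun y =>
    projZeroOne_of_mem_hodgeOneZero hXA (projOneZero_mem hXA y)
  have e3 : ∀ y, projOneZero hXA (projZeroOne hXA y) = 0 := fun y =>
    projOneZero_of_mem_hodgeZeroOne hXA (projZeroOne_mem hXA y)
  have e4 : ∀ y, projZeroOne hXA (projZeroOne hXA y) = projZeroOne hXA y := fun y =>
    projZeroOne_of_mem_hodgeZeroOne hXA (projZeroOne_mem hXA y)
  have hcomp : ∀ (s t : ℂ) (x : complexBetti (E.prod E).X 1),
      (s • projOneZero hXA + s⁻¹ • projZeroOne hXA) ((t • projOneZero hXA + t⁻¹ • projZeroOne hXA) x) =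
        (s * t) • projOneZero hXA x + (s * t)⁻¹ • projZeroOne hXA x := by
    intro s t x
    simp only [LinearMap.add_apply, LinearMap.smul_apply, map_add, map_smul, e1, e2, e3, e4, smul_zero,
      add_zero, zero_add, smul_smul, mul_inv]
    rw [mul_comm s t, mul_comm s⁻¹ t⁻¹]
  have hone : ∀ x : complexBetti (E.prod E).X 1,
      (1 : ℂ) • projOneZero hXA x + (1 : ℂ)⁻¹ • projZeroOne hXA x = x := by
    intro x
    rw [inv_one, one_smul, one_smul, projOneZero_add_projZeroOne]
  refine ⟨LinearEquiv.ofLinear (z • projOneZero hXA + z⁻¹ • projZeroOne hXA)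
      (z⁻¹ • projOneZero hXA + z⁻¹⁻¹ • projZeroOne hXA) (LinearMap.ext fun x => ?_) (LinearMap.ext fun x => ?_),
    fun x => rfl⟩
  · rw [LinearMap.comp_apply, hcomp, LinearMap.id_apply, mul_inv_cancel₀ hz]
    exact hone x
  · rw [LinearMap.comp_apply, hcomp, LinearMap.id_apply, inv_mul_cancel₀ hz]
    exact hone x

include hE hd₀ hψ in
/-- **The Hodge group of the square of a CM elliptic curve is NOT semisimple** on the tree's carriers:
`¬ HasSemisimpleHodgeGroup (E × E)`, i.e. the centre of `Hg(E × E)(ℂ)` is infinite. Indeed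
`Hg(E × E)(ℂ) ≅ Hg(E × E)(ℂ)|_{H¹}` (`hodgeGroup_ext_one`) is the Hodge circle (`mem_hodgeGroupOne_iff_circle`),
a commutative group with infinitely many elements (`z = 2, 3, 4, …` act differently on `p₁^*ω ≠ 0`), so its
centre is the whole group. (Gordon 2.12: the Hodge group of a non-zero abelian variety of CM type is a
non-trivial algebraic torus, in particular not semisimple; this is the first UNCONDITIONAL instance in the
tree — `exists_cmType_not_hasSemisimpleHodgeGroup_of` of `HodgeGroupProductSemisimpleCMFactor` derives one
from two facts.) [cite: Gordon1999HodgeAVSurvey, 2.12 Proposition and 1.3] [cite: MoonenZarhin1999LowDim, §2] -/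
theorem not_hasSemisimpleHodgeGroup : ¬ HasSemisimpleHodgeGroup (E.prod E) := by
  obtain ⟨ω₁, μ₁, hω, hω0, hgen, hgen', hωc0, hψω, hψω', hμ0⟩ := exists_cm_eigendata hE hd₀ hψ
  set hXA := Motives.isSmoothProjective_of_dim_eq' (dim_sq hE) with hXAdef
  have hcirc : ∀ u : complexBetti (E.prod E).X 1 ≃ₗ[ℂ] complexBetti (E.prod E).X 1,
      u ∈ hodgeGroupOne (E.prod E).dim (E.prod E).X ↔
        ∃ z : ℂ, z ≠ 0 ∧ ∀ x, u x = z • projOneZero hXA x + z⁻¹ • projZeroOne hXA x :=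
    fun u => mem_hodgeGroupOne_iff_circle hE hω hω0 hgen hgen' hωc0 hd₀ hψ hψω hψω' hμ0
  intro hfin
  have hfin' : Finite (Subgroup.center (hodgeGroup (E.prod E).dim (E.prod E).X)) := hfin
  -- (1) the closed form of a circle element on a "circle vector", and commutativity of `Hg|_{H¹}`
  have e1 : ∀ y, projOneZero hXA (projOneZero hXA y) = projOneZero hXA y := fun y =>
    projOneZero_of_mem_hodgeOneZero hXA (projOneZero_mem hXA y)
  have e2 : ∀ y, projZeroOne hXA (projOneZero hXA y) = 0 := fun y =>
    projZeroOne_of_mem_hodgeOneZero hXA (projOneZero_mem hXA y)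
  have e3 : ∀ y, projOneZero hXA (projZeroOne hXA y) = 0 := fun y =>
    projOneZero_of_mem_hodgeZeroOne hXA (projZeroOne_mem hXA y)
  have e4 : ∀ y, projZeroOne hXA (projZeroOne hXA y) = projZeroOne hXA y := fun y =>
    projZeroOne_of_mem_hodgeZeroOne hXA (projZeroOne_mem hXA y)
  have happly : ∀ {u : complexBetti (E.prod E).X 1 ≃ₗ[ℂ] complexBetti (E.prod E).X 1} {z : ℂ},
      (∀ x, u x = z • projOneZero hXA x + z⁻¹ • projZeroOne hXA x) → ∀ (s : ℂ) (x : complexBetti (E.prod E).X 1),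
        u (s • projOneZero hXA x + s⁻¹ • projZeroOne hXA x) =
          (z * s) • projOneZero hXA x + (z * s)⁻¹ • projZeroOne hXA x := by
    intro u z hz s x
    simp only [hz, map_add, map_smul, e1, e2, e3, e4, smul_zero, add_zero, zero_add, smul_smul, mul_inv]
  have hcomm : ∀ u v : complexBetti (E.prod E).X 1 ≃ₗ[ℂ] complexBetti (E.prod E).X 1,
      u ∈ hodgeGroupOne (E.prod E).dim (E.prod E).X → v ∈ hodgeGroupOne (E.prod E).dim (E.prod E).X →
        u * v = v * u := by
    intro u v hu hv
    obtain ⟨z, -, hz⟩ := (hcirc u).1 hu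
    obtain ⟨w, -, hw⟩ := (hcirc v).1 hv
    refine LinearEquiv.ext fun x => ?_
    change u (v x) = v (u x)
    rw [hw x, hz x, happly hz, happly hw, mul_comm z w]
  -- (2) `Hg(E × E)(ℂ)` is commutative, so its centre is everything; hence it is finite
  set G := hodgeGroup (E.prod E).dim (E.prod E).X with hGdef
  have hmem1 : ∀ g ∈ G, g 1 ∈ hodgeGroupOne (E.prod E).dim (E.prod E).X := fun g hg =>
    mem_hodgeGroupOne_iff.2 ⟨g, hg, rfl⟩
  have hGc : ∀ g ∈ G, ∀ g' ∈ G, g * g' = g' * g := fun g hg g' hg' =>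
    hodgeGroup_ext_one (G.mul_mem hg hg') (G.mul_mem hg' hg) (hcomm _ _ (hmem1 g hg) (hmem1 g' hg'))
  have htop : Subgroup.center G = ⊤ :=
    eq_top_iff.2 fun g _ => Subgroup.mem_center_iff.2 fun g' => Subtype.ext (hGc _ g'.2 _ g.2)
  haveI hGfin : Finite G := by
    haveI : Finite (⊤ : Subgroup G) := by rw [← htop]; exact hfin'
    exact Finite.of_equiv _ (Subgroup.topEquiv : (⊤ : Subgroup G) ≃* G).toEquiv
  -- (3) `Hg|_{H¹}`, a quotient of `Hg`, is finite
  haveI h1fin : Finite (hodgeGroupOne (E.prod E).dim (E.prod E).X) :=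
    Finite.of_surjective _
      ((Pi.evalMonoidHom (fun k : ℕ => complexBetti (E.prod E).X k ≃ₗ[ℂ] complexBetti (E.prod E).X k) 1).subgroupMap_surjective G)
  -- (4) but the circle elements `z = 2, 3, 4, …` are pairwise distinct members of `Hg|_{H¹}`
  have hF : ∀ n : ℕ, ∃ u : hodgeGroupOne (E.prod E).dim (E.prod E).X,
      ∀ x, (u : complexBetti (E.prod E).X 1 ≃ₗ[ℂ] complexBetti (E.prod E).X 1) x =
        ((n + 2 : ℕ) : ℂ) • projOneZero hXA x + ((n + 2 : ℕ) : ℂ)⁻¹ • projZeroOne hXA x := by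
    intro n
    have hz : ((n + 2 : ℕ) : ℂ) ≠ 0 := Nat.cast_ne_zero.2 (Nat.succ_ne_zero _)
    obtain ⟨u, hu⟩ := exists_circle_linearEquiv hE hz
    exact ⟨⟨u, (hcirc u).2 ⟨_, hz, hu⟩⟩, hu⟩
  choose F hF using hF
  have h10 : P₁ ω₁ ∈ hodgeOneZero hXA := (map_p_mem_hodgeOneZero hE hω).1
  have hne : P₁ ω₁ ≠ 0 := fun h0 => hω0 (by rw [← map_ι₁_map_p₁ ω₁, h0, map_zero])
  have hinj : Function.Injective F := by
    intro m n hmn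
    have h := hF m (P₁ ω₁)
    rw [hmn, hF n, projOneZero_of_mem_hodgeOneZero hXA h10, projZeroOne_of_mem_hodgeOneZero hXA h10, smul_zero,
      smul_zero, add_zero, add_zero] at h
    have h' : (((n + 2 : ℕ) : ℂ) - ((m + 2 : ℕ) : ℂ)) • P₁ ω₁ = 0 := by rw [sub_smul, h, sub_self]
    have h'' : ((n + 2 : ℕ) : ℂ) = ((m + 2 : ℕ) : ℂ) := sub_eq_zero.1 ((smul_eq_zero.1 h').resolve_right hne)
    have := Nat.cast_injective (R := ℂ) h''
    omega
  haveI := Finite.of_injective F hinj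
  exact not_finite ℕ

end Assembly

end Square

end CMSquare

/-! ### The refutation of the first typing, and a CM abelian variety with non-semisimple Hodge group -/

/-- **The first typing `HasSemisimpleHodgeGroup_of_hasHodgeGroupSU_statement` is false, given a CM elliptic
curve** `E` (`ψ ≫ ψ = -d₀`, `d₀ ≥ 1`): for `A = E × E`, `n = 1`, `φ = ψ × 2ψ`, `d = 0` and the `(1,1)`-class
`h₃` the hypothesis `HasHodgeGroupSU A φ 1 0 h₃` holds (`CMSquare.hasHodgeGroupSU`) while
`HasSemisimpleHodgeGroup A` fails (`CMSquare.not_hasSemisimpleHodgeGroup`). The statement omits the Weil-type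
hypotheses (`0 < d`, `φ ≫ φ = -d`, `h = d·e^*a + φ^*e^*a`) under which van Geemen 6.10–6.12 / Gordon 1.5 give
semisimplicity; the corrected statement is the tree's theorem
`VanGeemen1994.hasSemisimpleHodgeGroup_of_hasHodgeGroupSU_weilType`. [cite: vanGeemen1994HodgeAV, 5.3 and 6.9–6.12]
[cite: Gordon1999HodgeAVSurvey, 1.5 Examples and 2.12 Proposition] -/
theorem not_hasSemisimpleHodgeGroup_of_hasHodgeGroupSU_statement_of_cm {E : AbelianVariety ℂ} (hE : E.dim = 1)
    {ψ : E ⟶ E} {d₀ : ℕ} (hd₀ : 0 < d₀) (hψ : ψ ≫ ψ = -(d₀ • 𝟙 E)) :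
    ¬ HodgeTheory.HasSemisimpleHodgeGroup_of_hasHodgeGroupSU_statement := by
  intro h
  obtain ⟨ω, μ, hω, hω0, hgen, hgen', hωc0, hψω, hψω', hμ0⟩ := CMSquare.exists_cm_eigendata hE hd₀ hψ
  have hA2 : (E.prod E).dim = 2 * 1 := by rw [CMSquare.dim_sq hE]
  exact CMSquare.not_hasSemisimpleHodgeGroup hE hd₀ hψ
    (h (E.prod E) _ 1 0 _ one_pos hA2 (CMSquare.hasHodgeGroupSU hE hω hω0 hgen hgen' hωc0 hd₀ hψ hψω hψω' hμ0))

/-- **The first typing `HodgeTheory.HasSemisimpleHodgeGroup_of_hasHodgeGroupSU_statement` is FALSE**,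
unconditionally: an elliptic curve with complex multiplication by `√-1` exists in the tree
(`CMEndomorphism.exists_cmCurve_sqrt_neg`: `E = ℂ/ℤ[i]`). Negative knowledge for the Weil-type row of
`HodgeGroupProductSemisimpleCMFactor`; the docstring of the refuted definition already flags it as "expected to
be FALSE", and no theorem of the tree consumes it. [cite: vanGeemen1994HodgeAV, 5.3 and 6.9–6.12]
[cite: Gordon1999HodgeAVSurvey, 2.12 Proposition] [cite: LangeBirkenhake1992, §1.2] -/
theorem not_hasSemisimpleHodgeGroup_of_hasHodgeGroupSU_statement :
    ¬ HodgeTheory.HasSemisimpleHodgeGroup_of_hasHodgeGroupSU_statement := by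
  obtain ⟨E₀, ψ₀, hE₀, hψ₀⟩ :=
    Literature.NumberTheory.EllipticCurves.CMEndomorphism.exists_cmCurve_sqrt_neg 1 one_pos
  exact not_hasSemisimpleHodgeGroup_of_hasHodgeGroupSU_statement_of_cm hE₀ one_pos hψ₀

/-- `HasSemisimpleHodgeGroup_of_hasHodgeGroupSU_statement ↔ False`. [cite: vanGeemen1994HodgeAV, 6.9–6.12] -/
theorem hasSemisimpleHodgeGroup_of_hasHodgeGroupSU_statement_iff_false :
    HodgeTheory.HasSemisimpleHodgeGroup_of_hasHodgeGroupSU_statement ↔ False :=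
  iff_false_intro not_hasSemisimpleHodgeGroup_of_hasHodgeGroupSU_statement

/-- **A complex abelian variety of CM type whose Hodge group is not semisimple exists** — unconditionally:
`E × E` for `E = ℂ/ℤ[i]` (of CM type by `isOfCMType_of_cmCurve` and `IsOfCMType.prod`; non-semisimple by
`CMSquare.not_hasSemisimpleHodgeGroup`). This is the conclusion of
`HodgeTheory.exists_cmType_not_hasSemisimpleHodgeGroup_of` (there derived from Gordon's splitting fact and
Shioda's tightness fact) without any hypothesis: the semisimplicity hypothesis of Gordon's product theorem is
not redundant. (Gordon 2.12: `Hg` of a non-zero CM abelian variety is a torus.)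
[cite: Gordon1999HodgeAVSurvey, 2.12 Proposition] [cite: MoonenZarhin1999LowDim, §2] -/
theorem exists_isOfCMType_not_hasSemisimpleHodgeGroup :
    ∃ A : AbelianVariety ℂ, Milne1999.IsOfCMType A ∧ ¬ HasSemisimpleHodgeGroup A := by
  obtain ⟨E₀, ψ₀, hE₀, hψ₀⟩ :=
    Literature.NumberTheory.EllipticCurves.CMEndomorphism.exists_cmCurve_sqrt_neg 1 one_pos
  have hcm : Milne1999.IsOfCMType E₀ := isOfCMType_of_cmCurve hE₀ one_pos hψ₀
  exact ⟨E₀.prod E₀, hcm.prod hcm, CMSquare.not_hasSemisimpleHodgeGroup hE₀ one_pos hψ₀⟩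

end Literature.AlgebraicGeometry.VanGeemen1994

end
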